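import Mathlib.Analysis.InnerProductSpace.Calculus
import Mathlib.Analysis.InnerProductSpace.Dual
import Mathlib.Analysis.InnerProductSpace.PiL2
import Mathlib.Analysis.Normed.Module.FiniteDimension
import Mathlib.Analysis.Calculus.FDeriv.Symmetric
import Mathlib.Analysis.Calculus.LocalExtr.Rolle
import Mathlib.Analysis.Calculus.Deriv.MeanValue
import Mathlib.Analysis.SpecialFunctions.ExpDeriv
import Mathlib.Topology.MetricSpace.Thickening
import Mathlib.LinearAlgebra.BilinearForm.Properties
import HarnessLib

/-!
# The exp-height device: `e^{t⟪v,·⟫} F` has a unique interior critical point (calculus)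

Topic `Literature/Topology/FourManifolds`; groundwork for the fact seat
`provefact-Literature.Topology.FourManifolds.SphereEmbedding.schoenflies_exists_ball`
(Alexander's theorem / the Schönflies theorem in dimension three, Schultens (2014), Thm. 3.2.5).
**Everything in this file is proved; no definitions, no named facts.**  The sequel
`ExpHeightBall.lean` turns the main theorem into "`{F ≤ 0}` is diffeomorphic to the closed ball"
through the tree's Morse theory.

## The device

Let `A = {F ≤ 0} ⊂ E` be a compact regular domain in a finite-dimensional real inner product
space, presented by a `C²` function `F` with `DF ≠ 0` on the boundary `Z = {F = 0}`, and let
`v ≠ 0` be a direction.  The function `G_t = e^{t⟪v,·⟫} F` has the same zero set and the same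
sublevel set `{· ≤ 0}` as `F`, with `DG_t = e^{t⟪v,·⟫}(DF + t F ⟪v,·⟫)`, so its critical points
are the points where `DF(x) = -t F(x) ⟪v,·⟫`; in particular `‖DF(x)‖ = t |F(x)| ‖v‖` there
(§1).  For `t → ∞` the critical points inside `A` therefore concentrate at the boundary points
whose *outward* normal `DF` is a *positive* multiple of `⟪v, ·⟫` — the critical points of the
height `⟪v,·⟫|Z` with upward outward normal — and a nondegenerate local **maximum** `p₀` of the
height among them produces exactly **one** critical point of `G_t` nearby, a nondegenerate
local **minimum** (the dictionary "boundary critical point of boundary-stable type ↦ interior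
handle" of Morse theory on manifolds with boundary, realised by an explicit function).  When
`p₀` is the *only* upward-normal point, `G_t` is a Morse function near `A`, adapted to `∂A` in
the sense of Milnor, with a single critical point of index `0`, so `A` is a ball (Milnor, *Morse
theory* (1963), Thm. 3.1 with the Lemma of Morse; the sequel file) — e.g. for the region bounded
by a smooth sphere in `ℝ³` whose height function has exactly two critical points, the case
`n = 0` of Schultens' proof of Thm. 3.2.5 (PDF p. 44 of the held copy), without any
`2`-dimensional Schönflies theorem or isotopy of level discs.

## Contents (all elementary: two Rolle arguments, no implicit function theorem)

* §1 `G_t`: sign, zero set, `HasFDerivAt`, the critical-point equation and its consequences.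
* §2 derivatives of `θ ↦ F(x + θu)` and `θ ↦ DF(x + θu) w`.
* §3 splitting `u = w + s v̂`, `v̂ = v/‖v‖`, `w ⊥ v`.
* §4 **local uniqueness** (`critical_unique`): on a convex set `W` where `D²F ≥ q` on `vᗮ`,
  `‖D²F‖ ≤ M`, `DF(·) v̂ ≥ n₀ > 0` and `|DF(x) w| ≤ κ ‖w‖` (`w ⊥ v`, `κ M ≤ n₀ q / 2`), two
  critical points `x₁, x₂` of `G_t` coincide once `t ‖v‖ n₀ > 2M(M/q + 1)`: Rolle for
  `θ ↦ DF(x_θ) w` gives `q ‖w‖ ≤ M |s|` (`norm_perpV_le_of_critical`), and Rolle for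
  `θ ↦ DF(x_θ) v̂ + t‖v‖ F(x_θ)` then forces `s = 0`.
* §5 the Hessian of `G_t` at a critical point, `e^{t⟪v,x⟫}(D²F(u,u') + t DF(u) ⟪v,u'⟫)`, and
  its positivity (`fderiv_fderiv_expHeight_pos`) for `t ‖v‖ n₀ ≥ 2M²/q + M + 1`.
* §6 compactness: uniform gradient bound `‖DF‖ ≥ μ` on `{|F| ≤ ε}`; localisation of the
  points with `-ε ≤ F ≤ 0` and `DF ∈ ℝ₊⟪v,·⟫` near the upward-normal zeros.
* §7 the local constants at `p₀` from continuity, and uniform positivity on `vᗮ`.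
* §8 **main theorem** `exists_unique_critical`: `t`, `η` and the unique critical point `x₀` of
  `G_t` in `{F < η} ∩ (1-thickening of A)`, a local minimum with positive definite Hessian.
* §8b the top point: `⟪v,·⟫` is maximised on `A` at a boundary point `p` with
  `DF(p) ∈ ℝ_{>0} ⟪v,·⟫` (Lagrange) and `D²F(p)|vᗮ ≥ 0` (second order); positive definiteness
  from semidefiniteness and nondegeneracy; hence the hypotheses of the main theorem from
  "**the boundary points with `DF ∥ ⟪v,·⟫` are among two points, each with `D²F|vᗮ`
  nondegenerate**" (`exists_unique_upNormal_of_pair`) — the two-critical-point hypothesis of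
  Schultens' case `n = 0`.

## References

* J. Schultens, *Introduction to 3-Manifolds*, GSM 151 (2014), proof of Thm. 3.2.5, case
  `n = 0` (PDF p. 44 of the held copy `book:schultens2014-introduction-3-manifolds`).
  [Schultens2014]
* J. Milnor, *Morse theory*, Ann. of Math. Studies 51 (1963), §2 and Thm. 3.1. [Milnor1963]

## Design notes

* Pure theorems: the function is always written `fun x => Real.exp (t * ⟪v, x⟫) * F x` and the
  unit vector `‖v‖⁻¹ • v`, so that no definition is introduced.
* `IsMorse` in the tree is a global condition on the ambient manifold, and for `t ≫ 1` the
  function `G_t` (or any modification `e^{t⟪v,·⟫} m(F)`) unavoidably acquires critical points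
  just *outside* `A` near the downward-normal boundary points; the main theorem therefore
  localises to the open set `{F < η}`, `η = min ε₁ (μ/(2t‖v‖))`, which contains no exterior
  critical point (`‖DF‖ ≥ μ` near `Z`, but a critical point has `‖DF‖ = t F ‖v‖ < μ/2`), and
  the sequel works on this open submanifold of `ℝⁿ⁺¹`.
-/

open scoped RealInnerProductSpace Topology
open Set Filter Metric

noncomputable section

namespace Literature.Topology.FourManifolds

namespace ExpHeight

variable {E : Type*} [NormedAddCommGroup E] [InnerProductSpace ℝ E]

/-! ### §1 The function and its first derivative -/

/-- `e^{t⟪v,x⟫} F x ≤ 0 ↔ F x ≤ 0`. [folklore] -/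
theorem expHeight_nonpos_iff (t : ℝ) (v : E) (F : E → ℝ) (x : E) :
    Real.exp (t * ⟪v, x⟫) * F x ≤ 0 ↔ F x ≤ 0 := by
  have h := Real.exp_pos (t * ⟪v, x⟫)
  constructor
  · intro hx
    by_contra hF
    have : 0 < Real.exp (t * ⟪v, x⟫) * F x := mul_pos h (lt_of_not_ge hF)
    linarith
  · intro hx
    exact mul_nonpos_of_nonneg_of_nonpos h.le hx

/-- `e^{t⟪v,x⟫} F x = 0 ↔ F x = 0`. [folklore] -/
theorem expHeight_eq_zero_iff (t : ℝ) (v : E) (F : E → ℝ) (x : E) :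
    Real.exp (t * ⟪v, x⟫) * F x = 0 ↔ F x = 0 := by
  rw [mul_eq_zero, or_iff_right (Real.exp_pos _).ne']

/-- `e^{t⟪v,x⟫} F x < 0 ↔ F x < 0`. [folklore] -/
theorem expHeight_neg_iff (t : ℝ) (v : E) (F : E → ℝ) (x : E) :
    Real.exp (t * ⟪v, x⟫) * F x < 0 ↔ F x < 0 := by
  rw [lt_iff_le_and_ne, lt_iff_le_and_ne, expHeight_nonpos_iff, Ne, expHeight_eq_zero_iff]

/-- The derivative of the weight `x ↦ e^{t⟪v,x⟫}` is `e^{t⟪v,x⟫} t ⟪v, ·⟫`. [folklore] -/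
theorem hasFDerivAt_expWeight (t : ℝ) (v x : E) :
    HasFDerivAt (fun y : E => Real.exp (t * ⟪v, y⟫))
      (Real.exp (t * ⟪v, x⟫) • (t • innerSL ℝ v)) x := by
  have h1 : HasFDerivAt (fun y : E => t * ⟪v, y⟫) (t • innerSL ℝ v) x := by
    have := ((innerSL ℝ v).hasFDerivAt (x := x)).const_mul t
    simpa using this
  exact h1.exp

/-- The weight is `C^∞`. [folklore] -/
theorem contDiff_expWeight {n : WithTop ℕ∞} (t : ℝ) (v : E) :
    ContDiff ℝ n (fun y : E => Real.exp (t * ⟪v, y⟫)) :=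
  Real.contDiff_exp.comp (contDiff_const.mul (innerSL ℝ v).contDiff)

/-- The exp-height modification of a `Cⁿ` function is `Cⁿ`. [folklore] -/
theorem contDiff_expHeight {n : WithTop ℕ∞} {F : E → ℝ} (hF : ContDiff ℝ n F) (t : ℝ) (v : E) :
    ContDiff ℝ n (fun x => Real.exp (t * ⟪v, x⟫) * F x) :=
  (contDiff_expWeight t v).mul hF

/-- **First derivative**: `D(e^{t⟪v,·⟫} F)(x) = e^{t⟪v,x⟫} (DF(x) + t F(x) ⟪v, ·⟫)`. [folklore] -/
theorem hasFDerivAt_expHeight {F : E → ℝ} {F' : E →L[ℝ] ℝ} (t : ℝ) (v : E) {x : E}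
    (hF : HasFDerivAt F F' x) :
    HasFDerivAt (fun x => Real.exp (t * ⟪v, x⟫) * F x)
      (Real.exp (t * ⟪v, x⟫) • (F' + (t * F x) • innerSL ℝ v)) x := by
  have h := (hasFDerivAt_expWeight t v x).mul hF
  refine h.congr_fderiv ?_
  ext w
  simp only [add_apply, FunLike.coe_smul, Pi.smul_apply,
    smul_eq_mul, innerSL_apply_apply]
  ring

/-- The derivative of the exp-height modification of a differentiable function. [folklore] -/
theorem fderiv_expHeight {F : E → ℝ} (t : ℝ) (v : E) {x : E} (hF : DifferentiableAt ℝ F x) :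
    fderiv ℝ (fun x => Real.exp (t * ⟪v, x⟫) * F x) x =
      Real.exp (t * ⟪v, x⟫) • (fderiv ℝ F x + (t * F x) • innerSL ℝ v) :=
  (hasFDerivAt_expHeight t v hF.hasFDerivAt).fderiv

/-- **Critical points**: `x` is a critical point of `e^{t⟪v,·⟫} F` iff `DF(x) = -t F(x) ⟪v, ·⟫`.
[folklore] -/
theorem fderiv_expHeight_eq_zero_iff {F : E → ℝ} (t : ℝ) (v : E) {x : E}
    (hF : DifferentiableAt ℝ F x) :
    fderiv ℝ (fun x => Real.exp (t * ⟪v, x⟫) * F x) x = 0 ↔ fderiv ℝ F x = -(t * F x) • innerSL ℝ v := by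
  rw [fderiv_expHeight t v hF, smul_eq_zero, or_iff_right (Real.exp_pos _).ne', neg_smul,
    ← eq_neg_iff_add_eq_zero]

/-- At a critical point of `e^{t⟪v,·⟫} F`, `DF(x) w = -t F(x) ⟪v, w⟫`. [folklore] -/
theorem fderiv_apply_of_critical {F : E → ℝ} {t : ℝ} {v x : E} (hF : DifferentiableAt ℝ F x)
    (hx : fderiv ℝ (fun x => Real.exp (t * ⟪v, x⟫) * F x) x = 0) (w : E) :
    fderiv ℝ F x w = -(t * F x) * ⟪v, w⟫ := by
  rw [(fderiv_expHeight_eq_zero_iff t v hF).1 hx]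
  simp [innerSL_apply_apply]

/-- At a critical point, `DF(x) w = 0` for `w ⊥ v`. [folklore] -/
theorem fderiv_apply_eq_zero_of_critical {F : E → ℝ} {t : ℝ} {v x : E}
    (hF : DifferentiableAt ℝ F x) (hx : fderiv ℝ (fun x => Real.exp (t * ⟪v, x⟫) * F x) x = 0) {w : E}
    (hw : ⟪v, w⟫ = 0) : fderiv ℝ F x w = 0 := by
  rw [fderiv_apply_of_critical hF hx, hw, mul_zero]

/-- At a critical point, `DF(x) v = -t F(x) ‖v‖²`, i.e. `t ‖v‖² F(x) = -DF(x) v`. [folklore] -/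
theorem fderiv_apply_self_of_critical {F : E → ℝ} {t : ℝ} {v x : E}
    (hF : DifferentiableAt ℝ F x) (hx : fderiv ℝ (fun x => Real.exp (t * ⟪v, x⟫) * F x) x = 0) :
    fderiv ℝ F x v = -(t * F x) * ‖v‖ ^ 2 := by
  rw [fderiv_apply_of_critical hF hx, real_inner_self_eq_norm_sq]

/-- At a critical point the norm of `DF(x)` is `t |F(x)| ‖v‖`. [folklore] -/
theorem norm_fderiv_of_critical {F : E → ℝ} {t : ℝ} {v x : E}
    (hF : DifferentiableAt ℝ F x) (hx : fderiv ℝ (fun x => Real.exp (t * ⟪v, x⟫) * F x) x = 0) :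
    ‖fderiv ℝ F x‖ = |t * F x| * ‖v‖ := by
  rw [(fderiv_expHeight_eq_zero_iff t v hF).1 hx, norm_smul, norm_neg, innerSL_apply_norm,
    Real.norm_eq_abs]

/-! ### §2 Derivatives along a segment -/

section Segment

variable {F : E → ℝ}

/-- The segment `θ ↦ x + θ • u` has derivative `u`. [folklore] -/
theorem hasDerivAt_lineMap' (x u : E) (θ : ℝ) :
    HasDerivAt (fun θ : ℝ => x + θ • u) u θ := by
  simpa using ((hasDerivAt_id θ).smul_const u).const_add x

/-- Derivative of `θ ↦ F (x + θ u)`. [folklore] -/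
theorem hasDerivAt_comp_line (hF : Differentiable ℝ F) (x u : E) (θ : ℝ) :
    HasDerivAt (fun θ : ℝ => F (x + θ • u)) (fderiv ℝ F (x + θ • u) u) θ := by
  exact (hF (x + θ • u)).hasFDerivAt.comp_hasDerivAt θ (hasDerivAt_lineMap' x u θ)

/-- Derivative of `θ ↦ DF(x + θ u) w` is `D²F(x + θ u)(u)(w)`. [folklore] -/
theorem hasDerivAt_fderiv_comp_line_apply (hF : Differentiable ℝ (fderiv ℝ F)) (x u w : E)
    (θ : ℝ) :
    HasDerivAt (fun θ : ℝ => fderiv ℝ F (x + θ • u) w)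
      (fderiv ℝ (fderiv ℝ F) (x + θ • u) u w) θ := by
  have h1 : HasDerivAt (fun θ : ℝ => fderiv ℝ F (x + θ • u))
      (fderiv ℝ (fderiv ℝ F) (x + θ • u) u) θ :=
    (hF (x + θ • u)).hasFDerivAt.comp_hasDerivAt θ (hasDerivAt_lineMap' x u θ)
  have h2 := h1.clm_apply (hasDerivAt_const θ w)
  simpa using h2

end Segment

/-! ### §3 Splitting a vector along `v` -/

section Split

variable {v : E}

/-- `‖v/‖v‖‖ = 1`. [folklore] -/
theorem norm_unitVec (hv : v ≠ 0) : ‖‖v‖⁻¹ • v‖ = 1 := by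
  rw [norm_smul, norm_inv, norm_norm, inv_mul_cancel₀ (norm_ne_zero_iff.2 hv)]

/-- `⟪v, v/‖v‖⟫ = ‖v‖`. [folklore] -/
theorem inner_self_unitVec (hv : v ≠ 0) : ⟪v, ‖v‖⁻¹ • v⟫ = ‖v‖ := by
  rw [real_inner_smul_right, real_inner_self_eq_norm_sq, pow_two, ← mul_assoc,
    inv_mul_cancel₀ (norm_ne_zero_iff.2 hv), one_mul]

/-- `⟪v/‖v‖, u⟫ = ⟪v, u⟫/‖v‖`. [folklore] -/
theorem inner_unitVec_left (v u : E) : ⟪‖v‖⁻¹ • v, u⟫ = ‖v‖⁻¹ * ⟪v, u⟫ := by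
  rw [real_inner_smul_left]

/-- Splitting `u` into its components orthogonal to and along `v`. [folklore] -/
theorem perpV_add (v u : E) :
    (u - ⟪‖v‖⁻¹ • v, u⟫ • (‖v‖⁻¹ • v)) + ⟪‖v‖⁻¹ • v, u⟫ • (‖v‖⁻¹ • v) = u := by
  rw [sub_add_cancel]

/-- The component of `u` orthogonal to `v` is orthogonal to `v`. [folklore] -/
theorem inner_perpV (hv : v ≠ 0) (u : E) : ⟪v, u - ⟪‖v‖⁻¹ • v, u⟫ • (‖v‖⁻¹ • v)⟫ = 0 := by
  rw [inner_sub_right, real_inner_smul_right, inner_self_unitVec hv, inner_unitVec_left]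
  have hn : ‖v‖ ≠ 0 := norm_ne_zero_iff.2 hv
  field_simp
  ring

/-- `⟪v, u⟫ = ⟪v/‖v‖, u⟫ ‖v‖`. [folklore] -/
theorem inner_eq_coordV_mul (hv : v ≠ 0) (u : E) : ⟪v, u⟫ = ⟪‖v‖⁻¹ • v, u⟫ * ‖v‖ := by
  rw [inner_unitVec_left, mul_comm, ← mul_assoc, mul_inv_cancel₀ (norm_ne_zero_iff.2 hv),
    one_mul]

/-- `‖u‖ ≤ ‖u_⊥‖ + |u_v|` for the splitting along `v`. [folklore] -/
theorem norm_le_norm_perpV_add (hv : v ≠ 0) (u : E) :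
    ‖u‖ ≤ ‖u - ⟪‖v‖⁻¹ • v, u⟫ • (‖v‖⁻¹ • v)‖ + |⟪‖v‖⁻¹ • v, u⟫| := by
  conv_lhs => rw [← perpV_add v u]
  refine (norm_add_le _ _).trans ?_
  rw [norm_smul, norm_unitVec hv, mul_one, Real.norm_eq_abs]

/-- A vector with vanishing components orthogonal to and along `v` vanishes. [folklore] -/
theorem eq_zero_of_perpV_eq_zero (hv : v ≠ 0) {u : E} (hw : u - ⟪‖v‖⁻¹ • v, u⟫ • (‖v‖⁻¹ • v) = 0)
    (hs : ⟪‖v‖⁻¹ • v, u⟫ = 0) : u = 0 := by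
  have := norm_le_norm_perpV_add hv u
  rw [hw, hs, norm_zero, abs_zero, add_zero] at this
  exact norm_le_zero_iff.1 this

end Split

/-! ### §4 Local uniqueness of critical points near an upward-normal point -/

section Local

variable {F : E → ℝ} {v : E} {W : Set E} {q M n₀ κ t : ℝ}

/-- **`w`-control.** For two critical points `x₁, x₂ ∈ W` of `e^{t⟪v,·⟫} F`, the component
`w` of `x₂ - x₁` orthogonal to `v` is controlled by the component `s` along `v`:
`q ‖w‖ ≤ M |s|` (Rolle applied to `θ ↦ DF(x₁ + θ(x₂ - x₁)) w`, which vanishes at `θ = 0, 1`).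
[folklore] -/
theorem norm_perpV_le_of_critical (hF : ContDiff ℝ 2 F) (hv : v ≠ 0) (hW : Convex ℝ W)
    (hQ : ∀ x ∈ W, ∀ w : E, ⟪v, w⟫ = 0 → q * ‖w‖ ^ 2 ≤ fderiv ℝ (fderiv ℝ F) x w w)
    (hMb : ∀ x ∈ W, ‖fderiv ℝ (fderiv ℝ F) x‖ ≤ M)
    {x₁ x₂ : E} (hx₁ : x₁ ∈ W) (hx₂ : x₂ ∈ W)
    (h₁ : fderiv ℝ (fun x => Real.exp (t * ⟪v, x⟫) * F x) x₁ = 0) (h₂ : fderiv ℝ (fun x => Real.exp (t * ⟪v, x⟫) * F x) x₂ = 0) :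
    q * ‖((x₂ - x₁) - ⟪‖v‖⁻¹ • v, x₂ - x₁⟫ • (‖v‖⁻¹ • v))‖ ≤ M * |⟪‖v‖⁻¹ • v, x₂ - x₁⟫| := by
  have hFd : Differentiable ℝ F := hF.differentiable (by norm_num)
  have hF1 : ContDiff ℝ 1 (fderiv ℝ F) := ((contDiff_succ_iff_fderiv (n := 1)).1 hF).2.2
  have hFd' : Differentiable ℝ (fderiv ℝ F) := hF1.differentiable one_ne_zero
  set u := x₂ - x₁ with hu
  set w := (u - ⟪‖v‖⁻¹ • v, u⟫ • (‖v‖⁻¹ • v)) with hw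
  set s := ⟪‖v‖⁻¹ • v, u⟫ with hs
  have hvw : ⟪v, w⟫ = 0 := inner_perpV hv u
  -- Rolle for `g θ = DF(x₁ + θ u) w`
  set g : ℝ → ℝ := fun θ => fderiv ℝ F (x₁ + θ • u) w with hg
  have hg' : ∀ θ, HasDerivAt g (fderiv ℝ (fderiv ℝ F) (x₁ + θ • u) u w) θ :=
    fun θ => hasDerivAt_fderiv_comp_line_apply hFd' x₁ u w θ
  have hg0 : g 0 = 0 := by
    simp only [hg, zero_smul, add_zero]
    exact fderiv_apply_eq_zero_of_critical (hFd x₁) h₁ hvw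
  have hg1 : g 1 = 0 := by
    simp only [hg, one_smul, hu, add_sub_cancel]
    exact fderiv_apply_eq_zero_of_critical (hFd x₂) h₂ hvw
  obtain ⟨θ, hθ, hθ0⟩ := exists_hasDerivAt_eq_zero (f := g)
    (f' := fun θ => fderiv ℝ (fderiv ℝ F) (x₁ + θ • u) u w) zero_lt_one
    (fun θ _ => (hg' θ).continuousAt.continuousWithinAt) (hg0.trans hg1.symm) (fun θ _ => hg' θ)
  have hθW : x₁ + θ • u ∈ W := by
    rw [hu]; exact hW.add_smul_sub_mem hx₁ hx₂ ⟨hθ.1.le, hθ.2.le⟩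
  -- expand `u = w + s v̂` in the first slot
  have hsplit : fderiv ℝ (fderiv ℝ F) (x₁ + θ • u) w w =
      -(s * fderiv ℝ (fderiv ℝ F) (x₁ + θ • u) (‖v‖⁻¹ • v) w) := by
    have e1 : fderiv ℝ (fderiv ℝ F) (x₁ + θ • u) u =
        fderiv ℝ (fderiv ℝ F) (x₁ + θ • u) (w + s • (‖v‖⁻¹ • v)) := by rw [hw, hs, perpV_add]
    have : fderiv ℝ (fderiv ℝ F) (x₁ + θ • u) u w =
        fderiv ℝ (fderiv ℝ F) (x₁ + θ • u) w w +
          s * fderiv ℝ (fderiv ℝ F) (x₁ + θ • u) (‖v‖⁻¹ • v) w := by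
      rw [e1, map_add, map_smul, add_apply, FunLike.coe_smul, Pi.smul_apply, smul_eq_mul]
    linarith [hθ0]
  have hbound : |fderiv ℝ (fderiv ℝ F) (x₁ + θ • u) (‖v‖⁻¹ • v) w| ≤ M * ‖w‖ := by
    calc |fderiv ℝ (fderiv ℝ F) (x₁ + θ • u) (‖v‖⁻¹ • v) w|
        = ‖fderiv ℝ (fderiv ℝ F) (x₁ + θ • u) (‖v‖⁻¹ • v) w‖ := (Real.norm_eq_abs _).symm
      _ ≤ ‖fderiv ℝ (fderiv ℝ F) (x₁ + θ • u)‖ * ‖(‖v‖⁻¹ • v)‖ * ‖w‖ :=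
          ContinuousLinearMap.le_opNorm₂ _ _ _
      _ ≤ M * 1 * ‖w‖ := by
          rw [norm_unitVec hv]
          gcongr
          exact hMb _ hθW
      _ = M * ‖w‖ := by ring
  have hq : q * ‖w‖ ^ 2 ≤ |s| * (M * ‖w‖) := by
    calc q * ‖w‖ ^ 2 ≤ fderiv ℝ (fderiv ℝ F) (x₁ + θ • u) w w := hQ _ hθW w hvw
      _ = -(s * fderiv ℝ (fderiv ℝ F) (x₁ + θ • u) (‖v‖⁻¹ • v) w) := hsplit
      _ ≤ |s * fderiv ℝ (fderiv ℝ F) (x₁ + θ • u) (‖v‖⁻¹ • v) w| := neg_le_abs _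
      _ = |s| * |fderiv ℝ (fderiv ℝ F) (x₁ + θ • u) (‖v‖⁻¹ • v) w| := abs_mul _ _
      _ ≤ |s| * (M * ‖w‖) := by gcongr
  have hM0 : 0 ≤ M := le_trans (norm_nonneg (fderiv ℝ (fderiv ℝ F) x₁)) (hMb x₁ hx₁)
  by_cases hw0 : ‖w‖ = 0
  · rw [hw0, mul_zero]; positivity
  · have hwpos : 0 < ‖w‖ := lt_of_le_of_ne (norm_nonneg _) (Ne.symm hw0)
    have : q * ‖w‖ * ‖w‖ ≤ M * |s| * ‖w‖ := by nlinarith [hq]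
    exact le_of_mul_le_mul_right this hwpos

/-- **Local uniqueness of critical points.** On a convex set `W` on which `D²F ≥ q > 0`
transversally to `v`, `‖D²F‖ ≤ M`, `DF(·) v̂ ≥ n₀ > 0` and `|DF(x) w| ≤ κ ‖w‖` for `w ⊥ v`
with `κ M ≤ n₀ q / 2`, the function `e^{t⟪v,·⟫} F` has at most one critical point as soon as
`t ‖v‖ n₀ > 2 M (M / q + 1)`.  Proof: with the `w`-control, Rolle applied to
`θ ↦ DF(x_θ) v̂ + t ‖v‖ F(x_θ)` (which vanishes at both critical points) bounds
`t ‖v‖ n₀ |s|` by `(M (M/q + 1) + t ‖v‖ κ M / q) |s|`, forcing `s = 0`. [folklore] -/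
theorem critical_unique (hF : ContDiff ℝ 2 F) (hv : v ≠ 0) (hW : Convex ℝ W)
    (hq : 0 < q) (hn₀ : 0 < n₀) (hκ₀ : 0 ≤ κ)
    (hQ : ∀ x ∈ W, ∀ w : E, ⟪v, w⟫ = 0 → q * ‖w‖ ^ 2 ≤ fderiv ℝ (fderiv ℝ F) x w w)
    (hMb : ∀ x ∈ W, ‖fderiv ℝ (fderiv ℝ F) x‖ ≤ M)
    (hn : ∀ x ∈ W, n₀ ≤ fderiv ℝ F x (‖v‖⁻¹ • v))
    (hκ : ∀ x ∈ W, ∀ w : E, ⟪v, w⟫ = 0 → |fderiv ℝ F x w| ≤ κ * ‖w‖)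
    (hκM : κ * M ≤ n₀ * q / 2) (ht : 2 * M * (M / q + 1) < t * ‖v‖ * n₀)
    {x₁ x₂ : E} (hx₁ : x₁ ∈ W) (hx₂ : x₂ ∈ W)
    (h₁ : fderiv ℝ (fun x => Real.exp (t * ⟪v, x⟫) * F x) x₁ = 0) (h₂ : fderiv ℝ (fun x => Real.exp (t * ⟪v, x⟫) * F x) x₂ = 0) :
    x₁ = x₂ := by
  have hFd : Differentiable ℝ F := hF.differentiable (by norm_num)
  have hF1 : ContDiff ℝ 1 (fderiv ℝ F) := ((contDiff_succ_iff_fderiv (n := 1)).1 hF).2.2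
  have hFd' : Differentiable ℝ (fderiv ℝ F) := hF1.differentiable one_ne_zero
  have hM0 : 0 ≤ M := le_trans (norm_nonneg (fderiv ℝ (fderiv ℝ F) x₁)) (hMb x₁ hx₁)
  have hvn : 0 < ‖v‖ := norm_pos_iff.2 hv
  set u := x₂ - x₁ with hu
  set w := (u - ⟪‖v‖⁻¹ • v, u⟫ • (‖v‖⁻¹ • v)) with hw
  set s := ⟪‖v‖⁻¹ • v, u⟫ with hs
  have hvw : ⟪v, w⟫ = 0 := inner_perpV hv u
  have hwle : q * ‖w‖ ≤ M * |s| := norm_perpV_le_of_critical hF hv hW hQ hMb hx₁ hx₂ h₁ h₂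
  -- Rolle for `k θ = DF(x_θ) v̂ + t ‖v‖ F(x_θ)`
  set k : ℝ → ℝ := fun θ => fderiv ℝ F (x₁ + θ • u) (‖v‖⁻¹ • v) + t * ‖v‖ * F (x₁ + θ • u)
    with hk
  set k' : ℝ → ℝ := fun θ => fderiv ℝ (fderiv ℝ F) (x₁ + θ • u) u (‖v‖⁻¹ • v) +
    t * ‖v‖ * fderiv ℝ F (x₁ + θ • u) u with hk'
  have hkd : ∀ θ, HasDerivAt k (k' θ) θ := fun θ =>
    (hasDerivAt_fderiv_comp_line_apply hFd' x₁ u (‖v‖⁻¹ • v) θ).add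
      ((hasDerivAt_comp_line hFd x₁ u θ).const_mul (t * ‖v‖))
  have hcrit : ∀ x, fderiv ℝ (fun x => Real.exp (t * ⟪v, x⟫) * F x) x = 0 →
      fderiv ℝ F x (‖v‖⁻¹ • v) + t * ‖v‖ * F x = 0 := by
    intro x hx
    rw [fderiv_apply_of_critical (hFd x) hx, inner_self_unitVec hv]
    ring
  have hk0 : k 0 = 0 := by
    simp only [hk, zero_smul, add_zero]
    exact hcrit x₁ h₁
  have hk1 : k 1 = 0 := by
    simp only [hk, one_smul, hu, add_sub_cancel]
    exact hcrit x₂ h₂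
  obtain ⟨θ, hθ, hθ0⟩ := exists_hasDerivAt_eq_zero (f := k) (f' := k') zero_lt_one
    (fun θ _ => (hkd θ).continuousAt.continuousWithinAt) (hk0.trans hk1.symm) (fun θ _ => hkd θ)
  set x := x₁ + θ • u with hx
  have hxW : x ∈ W := by
    rw [hx, hu]; exact hW.add_smul_sub_mem hx₁ hx₂ ⟨hθ.1.le, hθ.2.le⟩
  -- expand `DF(x) u = DF(x) w + s DF(x) v̂`
  have e1 : u = w + s • (‖v‖⁻¹ • v) := by rw [hw, hs, perpV_add]
  have hDu : fderiv ℝ F x u = fderiv ℝ F x w + s * fderiv ℝ F x (‖v‖⁻¹ • v) := by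
    rw [e1, map_add, map_smul, smul_eq_mul]
  have hkey : t * ‖v‖ * (s * fderiv ℝ F x (‖v‖⁻¹ • v)) =
      -(fderiv ℝ (fderiv ℝ F) x u (‖v‖⁻¹ • v)) - t * ‖v‖ * fderiv ℝ F x w := by
    have h0 : k' θ = 0 := hθ0
    simp only [hk'] at h0
    rw [hDu] at h0
    linarith
  -- bounds
  have hb1 : |fderiv ℝ (fderiv ℝ F) x u (‖v‖⁻¹ • v)| ≤ M * (‖w‖ + |s|) := by
    calc |fderiv ℝ (fderiv ℝ F) x u (‖v‖⁻¹ • v)|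
        = ‖fderiv ℝ (fderiv ℝ F) x u (‖v‖⁻¹ • v)‖ := (Real.norm_eq_abs _).symm
      _ ≤ ‖fderiv ℝ (fderiv ℝ F) x‖ * ‖u‖ * ‖(‖v‖⁻¹ • v)‖ := ContinuousLinearMap.le_opNorm₂ _ _ _
      _ ≤ M * (‖w‖ + |s|) * 1 := by
          rw [norm_unitVec hv]
          gcongr
          · exact hMb x hxW
          · exact norm_le_norm_perpV_add hv u
      _ = M * (‖w‖ + |s|) := by ring
  have hb2 : |fderiv ℝ F x w| ≤ κ * ‖w‖ := hκ x hxW w hvw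
  have hnx : n₀ ≤ fderiv ℝ F x (‖v‖⁻¹ • v) := hn x hxW
  have ht0 : 0 < t := by
    by_contra h
    push Not at h
    have h1 : t * ‖v‖ * n₀ ≤ 0 :=
      mul_nonpos_of_nonpos_of_nonneg (mul_nonpos_of_nonpos_of_nonneg h hvn.le) hn₀.le
    have h2 : 0 ≤ 2 * M * (M / q + 1) := by positivity
    linarith
  -- the main inequality `t ‖v‖ n₀ |s| ≤ M (‖w‖ + |s|) + t ‖v‖ κ ‖w‖`
  have hmain : t * ‖v‖ * n₀ * |s| ≤ M * (‖w‖ + |s|) + t * ‖v‖ * (κ * ‖w‖) := by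
    have habs : |t * ‖v‖ * (s * fderiv ℝ F x (‖v‖⁻¹ • v))| ≤
        M * (‖w‖ + |s|) + t * ‖v‖ * (κ * ‖w‖) := by
      rw [hkey]
      calc |-(fderiv ℝ (fderiv ℝ F) x u (‖v‖⁻¹ • v)) - t * ‖v‖ * fderiv ℝ F x w|
          ≤ |-(fderiv ℝ (fderiv ℝ F) x u (‖v‖⁻¹ • v))| + |t * ‖v‖ * fderiv ℝ F x w| :=
            abs_sub _ _
        _ = |fderiv ℝ (fderiv ℝ F) x u (‖v‖⁻¹ • v)| + t * ‖v‖ * |fderiv ℝ F x w| := by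
            rw [abs_neg, abs_mul, abs_of_pos (mul_pos ht0 hvn)]
        _ ≤ M * (‖w‖ + |s|) + t * ‖v‖ * (κ * ‖w‖) := by gcongr
    have hlow : t * ‖v‖ * n₀ * |s| ≤ |t * ‖v‖ * (s * fderiv ℝ F x (‖v‖⁻¹ • v))| := by
      rw [abs_mul, abs_of_pos (mul_pos ht0 hvn), abs_mul,
        abs_of_pos (lt_of_lt_of_le hn₀ hnx)]
      have : 0 ≤ t * ‖v‖ * |s| := by positivity
      nlinarith [hnx, this]
    exact hlow.trans habs
  -- conclusion: `s = 0`, then `w = 0`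
  have hs0 : s = 0 := by
    by_contra hs0
    have hspos : 0 < |s| := abs_pos.2 hs0
    have i1 : M * (q * ‖w‖) ≤ M * (M * |s|) := mul_le_mul_of_nonneg_left hwle hM0
    have i2 : κ * (q * ‖w‖) ≤ κ * (M * |s|) := mul_le_mul_of_nonneg_left hwle hκ₀
    have i2' : κ * M * |s| ≤ n₀ * q / 2 * |s| := mul_le_mul_of_nonneg_right hκM (abs_nonneg s)
    have i3 : t * ‖v‖ * (κ * (q * ‖w‖)) ≤ t * ‖v‖ * (n₀ * q / 2 * |s|) :=
      mul_le_mul_of_nonneg_left (by linarith) (mul_pos ht0 hvn).le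
    have i4 : t * ‖v‖ * n₀ * |s| * q ≤ (M * (‖w‖ + |s|) + t * ‖v‖ * (κ * ‖w‖)) * q :=
      mul_le_mul_of_nonneg_right hmain hq.le
    have i5 : t * ‖v‖ * n₀ * q * |s| ≤ 2 * (M * M + M * q) * |s| := by linarith
    have i6 : 2 * M * (M / q + 1) * q = 2 * (M * M + M * q) := by
      field_simp
    have i7 : 2 * (M * M + M * q) < t * ‖v‖ * n₀ * q := by
      have := mul_lt_mul_of_pos_right ht hq
      rwa [i6] at this
    have i8 := mul_lt_mul_of_pos_right i7 hspos
    linarith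
  have hw0 : w = 0 := by
    have : q * ‖w‖ ≤ 0 := by simpa [hs0] using hwle
    have : ‖w‖ ≤ 0 := by
      by_contra h
      push Not at h
      have := mul_pos hq h
      linarith
    exact norm_le_zero_iff.1 this
  have hu0 : u = 0 := eq_zero_of_perpV_eq_zero hv (hw ▸ hw0) (hs ▸ hs0)
  rw [hu] at hu0
  exact (sub_eq_zero.1 hu0).symm

/-! ### §5 The Hessian at a critical point -/

/-- **The Hessian of `e^{t⟪v,·⟫} F` at a critical point `x`**:
`D²(e^{t⟪v,·⟫} F)(x)(u)(u') = e^{t⟪v,x⟫} (D²F(x)(u)(u') + t DF(x)(u) ⟪v, u'⟫)`; the terms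
involving the first derivative of the weight drop out because `DF(x) + t F(x) ⟪v,·⟫ = 0`.
[folklore] -/
theorem fderiv_fderiv_expHeight_of_critical (hF : ContDiff ℝ 2 F) {x : E}
    (hx : fderiv ℝ (fun x => Real.exp (t * ⟪v, x⟫) * F x) x = 0) (u u' : E) :
    fderiv ℝ (fderiv ℝ (fun x => Real.exp (t * ⟪v, x⟫) * F x)) x u u' =
      Real.exp (t * ⟪v, x⟫) *
        (fderiv ℝ (fderiv ℝ F) x u u' + t * fderiv ℝ F x u * ⟪v, u'⟫) := by
  have hFd : Differentiable ℝ F := hF.differentiable (by norm_num)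
  have hF1 : ContDiff ℝ 1 (fderiv ℝ F) := ((contDiff_succ_iff_fderiv (n := 1)).1 hF).2.2
  have hFd' : Differentiable ℝ (fderiv ℝ F) := hF1.differentiable one_ne_zero
  -- `D(e^{t⟪v,·⟫} F) = e • A` everywhere
  set e : E → ℝ := fun y => Real.exp (t * ⟪v, y⟫) with he
  set A : E → E →L[ℝ] ℝ := fun y => fderiv ℝ F y + (t * F y) • innerSL ℝ v with hA
  have hDG : fderiv ℝ (fun x => Real.exp (t * ⟪v, x⟫) * F x) = fun y => e y • A y := by
    funext y
    exact fderiv_expHeight t v (hFd y)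
  have hAx : A x = 0 := by
    have h := fderiv_expHeight t v (hFd x)
    rw [hx] at h
    exact ((smul_eq_zero.1 h.symm).resolve_left (Real.exp_pos _).ne').symm ▸ rfl
  have hA' : HasFDerivAt A
      (fderiv ℝ (fderiv ℝ F) x + (t • fderiv ℝ F x).smulRight (innerSL ℝ v)) x := by
    have h1 : HasFDerivAt (fderiv ℝ F) (fderiv ℝ (fderiv ℝ F) x) x := (hFd' x).hasFDerivAt
    have h2 : HasFDerivAt (fun y => (t * F y) • innerSL ℝ v)
        ((t • fderiv ℝ F x).smulRight (innerSL ℝ v)) x :=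
      ((hFd x).hasFDerivAt.const_mul t).smul_const (innerSL ℝ v)
    exact h1.add h2
  have he' : HasFDerivAt e (Real.exp (t * ⟪v, x⟫) • (t • innerSL ℝ v)) x :=
    hasFDerivAt_expWeight t v x
  have hG2 : HasFDerivAt (fderiv ℝ (fun x => Real.exp (t * ⟪v, x⟫) * F x))
      (e x • (fderiv ℝ (fderiv ℝ F) x + (t • fderiv ℝ F x).smulRight (innerSL ℝ v))) x := by
    rw [hDG]
    have h := he'.smul hA'
    rw [hAx, ContinuousLinearMap.smulRight_zero, add_zero] at h
    exact h
  rw [hG2.fderiv]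
  simp only [he, FunLike.coe_smul, Pi.smul_apply, add_apply,
    ContinuousLinearMap.smulRight_apply, smul_eq_mul, innerSL_apply_apply]

/-- **Positivity of the Hessian at a critical point near an upward-normal point.** With the
local bounds of `critical_unique` and `t ‖v‖ n₀ ≥ 2 M² / q + M + 1`, the Hessian of
`e^{t⟪v,·⟫} F` at a critical point `x ∈ W` is positive definite: writing `u = w + s v̂`,
`D²G(x)(u,u) = e^{t⟪v,x⟫} (D²F(x)(u,u) - t² F(x) ⟪v,u⟫²) ≥ e^{t⟪v,x⟫} (q ‖w‖² - 2 M |s| ‖w‖ - M s² + t ‖v‖ n₀ s²) > 0`.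
[folklore] -/
theorem fderiv_fderiv_expHeight_pos (hF : ContDiff ℝ 2 F) (hv : v ≠ 0)
    (hq : 0 < q) (hn₀ : 0 < n₀)
    (hQ : ∀ x ∈ W, ∀ w : E, ⟪v, w⟫ = 0 → q * ‖w‖ ^ 2 ≤ fderiv ℝ (fderiv ℝ F) x w w)
    (hMb : ∀ x ∈ W, ‖fderiv ℝ (fderiv ℝ F) x‖ ≤ M)
    (hn : ∀ x ∈ W, n₀ ≤ fderiv ℝ F x (‖v‖⁻¹ • v))
    (ht : 2 * M ^ 2 / q + M + 1 ≤ t * ‖v‖ * n₀)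
    {x : E} (hxW : x ∈ W) (hx : fderiv ℝ (fun x => Real.exp (t * ⟪v, x⟫) * F x) x = 0) {u : E} (hu : u ≠ 0) :
    0 < fderiv ℝ (fderiv ℝ (fun x => Real.exp (t * ⟪v, x⟫) * F x)) x u u := by
  have hFd : Differentiable ℝ F := hF.differentiable (by norm_num)
  have hM0 : 0 ≤ M := le_trans (norm_nonneg (fderiv ℝ (fderiv ℝ F) x)) (hMb x hxW)
  have hvn : 0 < ‖v‖ := norm_pos_iff.2 hv
  have ht0 : 0 < t := by
    by_contra h
    push Not at h
    have h1 : t * ‖v‖ * n₀ ≤ 0 :=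
      mul_nonpos_of_nonpos_of_nonneg (mul_nonpos_of_nonpos_of_nonneg h hvn.le) hn₀.le
    have h2 : 0 ≤ 2 * M ^ 2 / q := by positivity
    linarith
  set w := (u - ⟪‖v‖⁻¹ • v, u⟫ • (‖v‖⁻¹ • v)) with hw
  set s := ⟪‖v‖⁻¹ • v, u⟫ with hs
  have hvw : ⟪v, w⟫ = 0 := inner_perpV hv u
  have e1 : u = w + s • (‖v‖⁻¹ • v) := by rw [hw, hs, perpV_add]
  -- the value of `DF(x) u` and of `⟪v, u⟫`
  have hvu : ⟪v, u⟫ = s * ‖v‖ := inner_eq_coordV_mul hv u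
  have hnx : n₀ ≤ fderiv ℝ F x (‖v‖⁻¹ • v) := hn x hxW
  have hFx : fderiv ℝ F x (‖v‖⁻¹ • v) = -(t * F x) * ‖v‖ := by
    rw [fderiv_apply_of_critical (hFd x) hx, inner_self_unitVec hv]
  have hDu : fderiv ℝ F x u = -(t * F x) * (s * ‖v‖) := by
    rw [fderiv_apply_of_critical (hFd x) hx, hvu]
  -- expand the Hessian of `F`
  set D := fderiv ℝ (fderiv ℝ F) x with hD
  have hDexp : D u u = D w w + s * D w (‖v‖⁻¹ • v) + s * D (‖v‖⁻¹ • v) w +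
      s * s * D (‖v‖⁻¹ • v) (‖v‖⁻¹ • v) := by
    rw [e1]
    simp only [map_add, map_smul, add_apply, FunLike.coe_smul,
      Pi.smul_apply, smul_eq_mul]
    ring
  have hb : ∀ a b : E, |D a b| ≤ M * ‖a‖ * ‖b‖ := fun a b => by
    rw [← Real.norm_eq_abs]
    exact (ContinuousLinearMap.le_opNorm₂ D a b).trans (by gcongr; exact hMb x hxW)
  have h1 : |D w (‖v‖⁻¹ • v)| ≤ M * ‖w‖ := by simpa [norm_unitVec hv] using hb w (‖v‖⁻¹ • v)
  have h2 : |D (‖v‖⁻¹ • v) w| ≤ M * ‖w‖ := by simpa [norm_unitVec hv] using hb (‖v‖⁻¹ • v) w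
  have h3 : |D (‖v‖⁻¹ • v) (‖v‖⁻¹ • v)| ≤ M := by simpa [norm_unitVec hv] using hb (‖v‖⁻¹ • v) (‖v‖⁻¹ • v)
  have hQw : q * ‖w‖ ^ 2 ≤ D w w := hQ x hxW w hvw
  -- the formula for the Hessian of `G`
  have hformula : fderiv ℝ (fderiv ℝ (fun x => Real.exp (t * ⟪v, x⟫) * F x)) x u u =
      Real.exp (t * ⟪v, x⟫) * (D u u + t * ‖v‖ * fderiv ℝ F x (‖v‖⁻¹ • v) * s ^ 2) := by
    rw [fderiv_fderiv_expHeight_of_critical hF hx, hDu, hvu, hFx]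
    ring
  rw [hformula]
  refine mul_pos (Real.exp_pos _) ?_
  -- lower bound
  have hlow : q * ‖w‖ ^ 2 - 2 * M * |s| * ‖w‖ - M * s ^ 2 + t * ‖v‖ * n₀ * s ^ 2 ≤
      D u u + t * ‖v‖ * fderiv ℝ F x (‖v‖⁻¹ • v) * s ^ 2 := by
    rw [hDexp]
    have e2 : -(|s| * (M * ‖w‖)) ≤ s * D w (‖v‖⁻¹ • v) := by
      have h0 := neg_abs_le (s * D w (‖v‖⁻¹ • v))
      rw [abs_mul] at h0
      have := mul_le_mul_of_nonneg_left h1 (abs_nonneg s)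
      linarith
    have e3 : -(|s| * (M * ‖w‖)) ≤ s * D (‖v‖⁻¹ • v) w := by
      have h0 := neg_abs_le (s * D (‖v‖⁻¹ • v) w)
      rw [abs_mul] at h0
      have := mul_le_mul_of_nonneg_left h2 (abs_nonneg s)
      linarith
    have e4 : -(s * s * M) ≤ s * s * D (‖v‖⁻¹ • v) (‖v‖⁻¹ • v) := by
      have h0 := neg_abs_le (s * s * D (‖v‖⁻¹ • v) (‖v‖⁻¹ • v))
      rw [abs_mul, abs_mul_self] at h0
      have := mul_le_mul_of_nonneg_left h3 (mul_self_nonneg s)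
      linarith
    have e5 : t * ‖v‖ * s ^ 2 * n₀ ≤ t * ‖v‖ * s ^ 2 * fderiv ℝ F x (‖v‖⁻¹ • v) :=
      mul_le_mul_of_nonneg_left hnx (by positivity)
    have hss : s * s = s ^ 2 := (sq s).symm
    have hsa : |s| * |s| = s ^ 2 := by rw [← sq, sq_abs]
    nlinarith [hQw, e2, e3, e4, e5, hss, hsa]
  refine lt_of_lt_of_le ?_ hlow
  -- positivity of the quadratic lower bound
  by_cases hs0 : s = 0
  · have hw0 : w ≠ 0 := by
      intro hw0
      exact hu (eq_zero_of_perpV_eq_zero hv (hw ▸ hw0) (hs ▸ hs0))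
    have : 0 < ‖w‖ := norm_pos_iff.2 hw0
    rw [hs0]
    simp only [abs_zero, mul_zero, zero_mul, sub_zero, add_zero, ne_eq, OfNat.ofNat_ne_zero,
      not_false_eq_true, zero_pow]
    positivity
  · have hspos : 0 < s ^ 2 := by positivity
    -- `q a² - 2 M a b + (2M²/q) b² ≥ 0` with `a = ‖w‖`, `b = |s|`
    have key : 0 ≤ q * ‖w‖ ^ 2 - 2 * M * |s| * ‖w‖ + 2 * M ^ 2 / q * |s| ^ 2 := by
      have : q * ‖w‖ ^ 2 - 2 * M * |s| * ‖w‖ + 2 * M ^ 2 / q * |s| ^ 2 =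
          q * (‖w‖ - M / q * |s|) ^ 2 + M ^ 2 / q * |s| ^ 2 := by
        field_simp
        ring
      rw [this]
      positivity
    rw [sq_abs] at key
    have ht' : (2 * M ^ 2 / q + M + 1) * s ^ 2 ≤ t * ‖v‖ * n₀ * s ^ 2 :=
      mul_le_mul_of_nonneg_right ht hspos.le
    linarith

end Local

section Global

variable [FiniteDimensional ℝ E]

/-! ### §6 Compactness lemmas -/

/-- **Uniformity from compactness.** If a monotone family of closed sets `P ε`, `ε > 0`,
shrinks inside the compact set `s` into the open set `U` (every point of `s` lying in all
`P ε` lies in `U`), then already `s ∩ P ε ⊆ U` for some `ε > 0`. [folklore] -/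
theorem exists_pos_inter_subset {X : Type*} [TopologicalSpace X] {s U : Set X}
    (hs : IsCompact s) (hU : IsOpen U) {P : ℝ → Set X}
    (hP : ∀ ε, 0 < ε → IsClosed (P ε)) (hmono : ∀ ε ε', 0 < ε → ε ≤ ε' → P ε ⊆ P ε')
    (h : ∀ x ∈ s, (∀ ε, 0 < ε → x ∈ P ε) → x ∈ U) :
    ∃ ε, 0 < ε ∧ s ∩ P ε ⊆ U := by
  have hs' : IsCompact (s \ U) := hs.diff hU
  haveI : Nonempty {ε : ℝ // 0 < ε} := ⟨⟨1, one_pos⟩⟩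
  obtain ⟨⟨ε, hε⟩, hεs⟩ := hs'.elim_directed_family_closed (fun ε : {ε : ℝ // 0 < ε} => P ε.1)
    (fun ε => hP ε.1 ε.2)
    (eq_empty_iff_forall_notMem.2 fun x hx =>
      hx.1.2 (h x hx.1.1 fun ε hε => mem_iInter.1 hx.2 ⟨ε, hε⟩))
    (by
      rintro ⟨ε₁, h₁⟩ ⟨ε₂, h₂⟩
      refine ⟨⟨min ε₁ ε₂, lt_min h₁ h₂⟩, ?_, ?_⟩
      · exact hmono _ _ (lt_min h₁ h₂) (min_le_left _ _)
      · exact hmono _ _ (lt_min h₁ h₂) (min_le_right _ _))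
  refine ⟨ε, hε, fun x hx => ?_⟩
  by_contra hxU
  have : x ∈ (s \ U) ∩ P ε := ⟨⟨hx.1, hxU⟩, hx.2⟩
  rw [hεs] at this
  exact this

variable {F : E → ℝ} {v : E}

omit [FiniteDimensional ℝ E] in
/-- **A uniform lower bound for the gradient near the zero set.** If `DF ≠ 0` on the zero set of
`F` inside the compact set `L`, then `‖DF‖ ≥ μ > 0` on `{x ∈ L | |F x| ≤ ε}` for some
`μ, ε > 0`. [folklore] -/
theorem exists_norm_fderiv_ge (hF : ContDiff ℝ 1 F) {L : Set E} (hL : IsCompact L)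
    (hreg : ∀ x ∈ L, F x = 0 → fderiv ℝ F x ≠ 0) :
    ∃ μ, 0 < μ ∧ ∃ ε, 0 < ε ∧ ∀ x ∈ L, |F x| ≤ ε → μ ≤ ‖fderiv ℝ F x‖ := by
  have hFc : Continuous F := hF.continuous
  have hDc : Continuous (fderiv ℝ F) := hF.continuous_fderiv one_ne_zero
  set Z : Set E := L ∩ F ⁻¹' {0} with hZ
  have hZc : IsCompact Z := hL.inter_right (isClosed_singleton.preimage hFc)
  -- a positive lower bound `2μ` on `Z`
  obtain ⟨μ, hμ, hμZ⟩ : ∃ μ, 0 < μ ∧ ∀ x ∈ Z, 2 * μ ≤ ‖fderiv ℝ F x‖ := by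
    by_cases hne : Z.Nonempty
    · obtain ⟨x₀, hx₀, hmin⟩ :=
        hZc.exists_isMinOn hne (continuous_norm.comp hDc).continuousOn
      have hpos : 0 < ‖fderiv ℝ F x₀‖ := norm_pos_iff.2 (hreg x₀ hx₀.1 hx₀.2)
      exact ⟨‖fderiv ℝ F x₀‖ / 2, by positivity, fun x hx => by
        have h' : ‖fderiv ℝ F x₀‖ ≤ ‖fderiv ℝ F x‖ := hmin hx
        linarith⟩
    · refine ⟨1, one_pos, fun x hx => (hne ⟨x, hx⟩).elim⟩
  refine ⟨μ, hμ, ?_⟩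
  -- the open set `{μ < ‖DF‖}` contains `Z`; compactness gives a uniform `ε`
  obtain ⟨ε, hε, hsub⟩ := exists_pos_inter_subset hL (isOpen_lt continuous_const
      (continuous_norm.comp hDc)) (P := fun ε => {x | |F x| ≤ ε})
    (fun ε _ => isClosed_le (continuous_abs.comp hFc) continuous_const)
    (fun ε ε' _ h x hx => le_trans (show |F x| ≤ ε from hx) h)
    (fun x hxL hall => by
      have hx0 : F x = 0 := by
        by_contra h0
        have hpos : 0 < |F x| := abs_pos.2 h0
        have h' : |F x| ≤ |F x| / 2 := hall (|F x| / 2) (by positivity)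
        linarith
      have := hμZ x ⟨hxL, hx0⟩
      show μ < ‖fderiv ℝ F x‖
      linarith)
  exact ⟨ε, hε, fun x hxL hxε => le_of_lt (hsub ⟨hxL, hxε⟩)⟩

omit [FiniteDimensional ℝ E] in
/-- The closed cone condition "`DF(x)` is a nonnegative multiple of `⟪v, ·⟫`" in closed form.
[folklore] -/
theorem exists_nonneg_eq_smul_iff (hv : v ≠ 0) (A : E →L[ℝ] ℝ) :
    (∃ c : ℝ, 0 ≤ c ∧ A = c • innerSL ℝ v) ↔
      A = ((‖v‖ ^ 2)⁻¹ * A v) • innerSL ℝ v ∧ 0 ≤ A v := by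
  have hv2 : 0 < ‖v‖ ^ 2 := by positivity
  constructor
  · rintro ⟨c, hc, rfl⟩
    have hAv : (c • innerSL ℝ v) v = c * ‖v‖ ^ 2 := by
      simp [innerSL_apply_apply]
    refine ⟨?_, ?_⟩
    · rw [hAv]
      congr 1
      field_simp
    · rw [hAv]; positivity
  · rintro ⟨hA, hAv⟩
    exact ⟨(‖v‖ ^ 2)⁻¹ * A v, by positivity, hA⟩

omit [FiniteDimensional ℝ E] in
/-- **Localisation of the upward-normal critical candidates.** Let `L` be compact and `W` open,
and suppose every zero `x ∈ L` of `F` at which `DF(x)` is a nonnegative multiple of `⟪v,·⟫` lies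
in `W`.  Then for some `ε > 0` every `x ∈ L` with `-ε ≤ F x ≤ 0` and `DF(x) ∈ ℝ₊ ⟪v, ·⟫` lies
in `W`. [folklore] -/
theorem exists_pos_forall_mem_of_cone (hF : ContDiff ℝ 1 F) (hv : v ≠ 0) {L W : Set E}
    (hL : IsCompact L) (hW : IsOpen W)
    (h : ∀ x ∈ L, F x = 0 → (∃ c : ℝ, 0 ≤ c ∧ fderiv ℝ F x = c • innerSL ℝ v) → x ∈ W) :
    ∃ ε, 0 < ε ∧ ∀ x ∈ L, -ε ≤ F x → F x ≤ 0 →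
      (∃ c : ℝ, 0 ≤ c ∧ fderiv ℝ F x = c • innerSL ℝ v) → x ∈ W := by
  have hFc : Continuous F := hF.continuous
  have hDc : Continuous (fderiv ℝ F) := hF.continuous_fderiv one_ne_zero
  set C : Set E := {x | fderiv ℝ F x = ((‖v‖ ^ 2)⁻¹ * fderiv ℝ F x v) • innerSL ℝ v ∧
    0 ≤ fderiv ℝ F x v} with hC
  have hCc : IsClosed C := by
    have h1 : Continuous fun x => fderiv ℝ F x v := (ContinuousLinearMap.apply ℝ ℝ v).continuous.comp hDc
    refine IsClosed.inter (isClosed_eq hDc ?_) (isClosed_le continuous_const h1)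
    exact ((continuous_const.mul h1).smul continuous_const)
  have hCiff : ∀ x, x ∈ C ↔ ∃ c : ℝ, 0 ≤ c ∧ fderiv ℝ F x = c • innerSL ℝ v := fun x => by
    rw [exists_nonneg_eq_smul_iff hv]; rfl
  obtain ⟨ε, hε, hsub⟩ := exists_pos_inter_subset hL hW
    (P := fun ε => {x | -ε ≤ F x} ∩ {x | F x ≤ 0} ∩ C)
    (fun ε _ => ((isClosed_le continuous_const hFc).inter (isClosed_le hFc continuous_const)).inter hCc)
    (fun ε ε' _ hle x hx => ⟨⟨le_trans (neg_le_neg hle) hx.1.1, hx.1.2⟩, hx.2⟩)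
    (fun x hxL hall => by
      have h1 := hall 1 one_pos
      have hx0 : F x = 0 := by
        refine le_antisymm h1.1.2 ?_
        by_contra hlt
        push Not at hlt
        have h' : -(-F x / 2) ≤ F x := (hall (-F x / 2) (by linarith)).1.1
        linarith
      exact h x hxL hx0 ((hCiff x).1 h1.2))
  exact ⟨ε, hε, fun x hxL h1 h2 h3 => hsub ⟨hxL, ⟨h1, h2⟩, (hCiff x).2 h3⟩⟩

/-! ### §7 Local constants at the upward-normal point -/

/-- **Uniform positivity on `vᗮ`.** A bilinear form which is positive on the nonzero vectors
orthogonal to `v` is bounded below there by `q ‖w‖²` for some `q > 0` (compactness of the unit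
sphere of `vᗮ`). [folklore] -/
theorem exists_pos_mul_norm_sq_le (D : E →L[ℝ] E →L[ℝ] ℝ)
    (hpos : ∀ w, ⟪v, w⟫ = 0 → w ≠ 0 → 0 < D w w) :
    ∃ q, 0 < q ∧ ∀ w, ⟪v, w⟫ = 0 → q * ‖w‖ ^ 2 ≤ D w w := by
  set S : Set E := sphere (0 : E) 1 ∩ {w | ⟪v, w⟫ = 0} with hS
  have hSc : IsCompact S := (isCompact_sphere 0 1).inter_right
    (isClosed_eq (continuous_const.inner continuous_id) continuous_const)
  have hcont : Continuous fun w : E => D w w :=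
    (D.continuous₂).comp (continuous_id.prodMk continuous_id)
  have key : ∀ q, (∀ w ∈ S, q ≤ D w w) → ∀ w, ⟪v, w⟫ = 0 → q * ‖w‖ ^ 2 ≤ D w w := by
    intro q hq w hvw
    by_cases hw : w = 0
    · subst hw; simp
    · have hn : ‖w‖ ≠ 0 := norm_ne_zero_iff.2 hw
      have hmem : ‖w‖⁻¹ • w ∈ S := by
        refine ⟨?_, ?_⟩
        · simp [norm_smul, inv_mul_cancel₀ hn]
        · show ⟪v, ‖w‖⁻¹ • w⟫ = 0
          rw [real_inner_smul_right, hvw, mul_zero]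
      have h1 := hq _ hmem
      have h2 : D (‖w‖⁻¹ • w) (‖w‖⁻¹ • w) = (‖w‖ ^ 2)⁻¹ * D w w := by
        simp only [map_smul, FunLike.coe_smul, Pi.smul_apply, smul_eq_mul]
        rw [← mul_assoc, ← mul_inv, ← pow_two]
      rw [h2] at h1
      have h3 : 0 < ‖w‖ ^ 2 := by positivity
      have := mul_le_mul_of_nonneg_left h1 h3.le
      rwa [← mul_assoc, mul_inv_cancel₀ h3.ne', one_mul, mul_comm] at this
  by_cases hne : S.Nonempty
  · obtain ⟨w₀, hw₀, hmin⟩ := hSc.exists_isMinOn hne hcont.continuousOn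
    have hw₀ne : w₀ ≠ 0 := by
      intro h; rw [h] at hw₀; simp [hS] at hw₀
    refine ⟨D w₀ w₀, hpos w₀ hw₀.2 hw₀ne, key _ fun w hw => hmin hw⟩
  · refine ⟨1, one_pos, key 1 fun w hw => (hne ⟨w, hw⟩).elim⟩

/-- **Local constants at an upward-normal point.** If `DF(p₀) = c₀ ⟪v,·⟫` with `c₀ > 0` and
`D²F(p₀)` is positive on `vᗮ ∖ {0}`, then on a small ball around `p₀` the hypotheses of
`critical_unique` and `fderiv_fderiv_expHeight_pos` hold with explicit constants. [folklore] -/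
theorem exists_local_constants (hF : ContDiff ℝ 2 F) (hv : v ≠ 0) {p₀ : E} {c₀ : ℝ}
    (hc₀ : 0 < c₀) (hDp₀ : fderiv ℝ F p₀ = c₀ • innerSL ℝ v)
    (hpos : ∀ w, ⟪v, w⟫ = 0 → w ≠ 0 → 0 < fderiv ℝ (fderiv ℝ F) p₀ w w) :
    ∃ q M n₀ κ ρ : ℝ, 0 < q ∧ 0 < M ∧ 0 < n₀ ∧ 0 ≤ κ ∧ 0 < ρ ∧ ρ ≤ 1 ∧
      κ * M ≤ n₀ * q / 2 ∧
      (∀ x ∈ ball p₀ ρ, ∀ w : E, ⟪v, w⟫ = 0 → q * ‖w‖ ^ 2 ≤ fderiv ℝ (fderiv ℝ F) x w w) ∧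
      (∀ x ∈ ball p₀ ρ, ‖fderiv ℝ (fderiv ℝ F) x‖ ≤ M) ∧
      (∀ x ∈ ball p₀ ρ, n₀ ≤ fderiv ℝ F x (‖v‖⁻¹ • v)) ∧
      (∀ x ∈ ball p₀ ρ, ∀ w : E, ⟪v, w⟫ = 0 → |fderiv ℝ F x w| ≤ κ * ‖w‖) := by
  have hF1 : ContDiff ℝ 1 (fderiv ℝ F) := ((contDiff_succ_iff_fderiv (n := 1)).1 hF).2.2
  have hDc : Continuous (fderiv ℝ F) := hF.continuous_fderiv (by norm_num)
  have hD2c : Continuous (fderiv ℝ (fderiv ℝ F)) := hF1.continuous_fderiv one_ne_zero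
  set D2 := fderiv ℝ (fderiv ℝ F) with hD2
  obtain ⟨q, hq, hQ0⟩ := exists_pos_mul_norm_sq_le (v := v) (D2 p₀) hpos
  have hvn : 0 < ‖v‖ := norm_pos_iff.2 hv
  set M : ℝ := ‖D2 p₀‖ + 1 with hM
  have hM0 : 0 < M := by positivity
  set n₀ : ℝ := c₀ * ‖v‖ / 2 with hn₀
  have hn₀0 : 0 < n₀ := by positivity
  set κ : ℝ := n₀ * (q / 2) / (2 * M) with hκ
  have hκ0 : 0 < κ := by positivity
  -- neighbourhood from continuity
  have h1 := ((tendsto_iff_norm_sub_tendsto_zero (f := D2) (b := D2 p₀)).1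
    (hD2c.tendsto p₀)).eventually (gt_mem_nhds (lt_min (half_pos hq) one_pos))
  have h2 := ((tendsto_iff_norm_sub_tendsto_zero (f := fun x => fderiv ℝ F x (‖v‖⁻¹ • v))
    (b := fderiv ℝ F p₀ (‖v‖⁻¹ • v))).1
    ((((ContinuousLinearMap.apply ℝ ℝ (‖v‖⁻¹ • v)).continuous.comp hDc).tendsto p₀))).eventually
      (gt_mem_nhds hn₀0)
  have h3 := ((tendsto_iff_norm_sub_tendsto_zero (f := fderiv ℝ F) (b := fderiv ℝ F p₀)).1
    (hDc.tendsto p₀)).eventually (gt_mem_nhds hκ0)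
  obtain ⟨ρ₀, hρ₀, hball⟩ := Metric.eventually_nhds_iff_ball.1 (h1.and (h2.and h3))
  refine ⟨q / 2, M, n₀, κ, min ρ₀ 1, by positivity, hM0, hn₀0, hκ0.le, lt_min hρ₀ one_pos,
    min_le_right _ _, ?_, ?_, ?_, ?_, ?_⟩
  · -- `κ M = n₀ (q/2) / 2`
    have : κ * M = n₀ * (q / 2) / 2 := by
      rw [hκ]
      field_simp
    rw [this]
  · intro x hx w hw
    have hx' : x ∈ ball p₀ ρ₀ := ball_subset_ball (min_le_left _ _) hx
    have hd : ‖D2 x - D2 p₀‖ < q / 2 := lt_of_lt_of_le (hball x hx').1 (min_le_left _ _)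
    have hdiff : |D2 x w w - D2 p₀ w w| ≤ q / 2 * ‖w‖ ^ 2 := by
      have : D2 x w w - D2 p₀ w w = (D2 x - D2 p₀) w w := by
        simp only [sub_apply]
      rw [this, ← Real.norm_eq_abs]
      calc ‖(D2 x - D2 p₀) w w‖ ≤ ‖D2 x - D2 p₀‖ * ‖w‖ * ‖w‖ :=
            ContinuousLinearMap.le_opNorm₂ _ _ _
        _ ≤ q / 2 * ‖w‖ * ‖w‖ := by gcongr
        _ = q / 2 * ‖w‖ ^ 2 := by ring
    have h0 := hQ0 w hw
    have := neg_abs_le (D2 x w w - D2 p₀ w w)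
    show q / 2 * ‖w‖ ^ 2 ≤ D2 x w w
    linarith
  · intro x hx
    have hx' : x ∈ ball p₀ ρ₀ := ball_subset_ball (min_le_left _ _) hx
    have hd : ‖D2 x - D2 p₀‖ < 1 := lt_of_lt_of_le (hball x hx').1 (min_le_right _ _)
    have := norm_sub_norm_le (D2 x) (D2 p₀)
    show ‖D2 x‖ ≤ ‖D2 p₀‖ + 1
    linarith
  · intro x hx
    have hx' : x ∈ ball p₀ ρ₀ := ball_subset_ball (min_le_left _ _) hx
    have hd := (hball x hx').2.1
    rw [Real.norm_eq_abs] at hd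
    have hp : fderiv ℝ F p₀ (‖v‖⁻¹ • v) = 2 * n₀ := by
      rw [hDp₀, FunLike.coe_smul, Pi.smul_apply, innerSL_apply_apply,
        inner_self_unitVec hv, smul_eq_mul, hn₀]
      ring
    rw [hp] at hd
    have := neg_abs_le (fderiv ℝ F x (‖v‖⁻¹ • v) - 2 * n₀)
    linarith [abs_lt.1 hd]
  · intro x hx w hw
    have hx' : x ∈ ball p₀ ρ₀ := ball_subset_ball (min_le_left _ _) hx
    have hd := (hball x hx').2.2
    have hp : fderiv ℝ F p₀ w = 0 := by
      rw [hDp₀, FunLike.coe_smul, Pi.smul_apply, innerSL_apply_apply, hw, smul_zero]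
    have : fderiv ℝ F x w = (fderiv ℝ F x - fderiv ℝ F p₀) w := by
      rw [sub_apply, hp, sub_zero]
    rw [this, ← Real.norm_eq_abs]
    exact (ContinuousLinearMap.le_opNorm _ _).trans (by gcongr)

/-! ### §8 The unique interior critical point -/

/-- **Main theorem (calculus form): a unique interior critical point.**  Let `F : E → ℝ` be `C²`
with `A = {F ≤ 0}` compact, `{F < 0}` nonempty and `DF ≠ 0` on `Z = {F = 0}`; let `v ≠ 0` and
let `p₀ ∈ Z` be the *only* point of `Z` at which `DF` is a positive multiple of `⟪v, ·⟫` (an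
"upward-normal" point), the Hessian `D²F(p₀)` being positive on the nonzero vectors orthogonal
to `v` (equivalently: the height `⟪v, ·⟫|Z` has a nondegenerate local maximum at `p₀`).  Then
there are a rate `t > 0`, a margin `η > 0` and a point `x₀` with `F x₀ < 0` such that `x₀` is a
critical point and a local minimum of `G = e^{t⟪v,·⟫} F` with positive definite Hessian, and
`x₀` is the **only** critical point of `G` in the open neighbourhood
`{F < η} ∩ (1-thickening of A)` of `A`.
Assembly of §4–§7: `t` is chosen larger than the two local thresholds at `p₀` and than
`sup ‖DF‖ / (ε ‖v‖)`; deep points (`F ≤ -ε`) and outer points (`0 < F < η ≤ μ/(2t‖v‖)`) cannot be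
critical by comparing `‖DF(x)‖ = t |F(x)| ‖v‖` with the bounds `‖DF‖ ≤ sup` and `‖DF‖ ≥ μ` near
`Z`; shallow interior critical points lie in the small ball around `p₀` (compactness), where the
critical point is unique; the minimum of `G` on `{F ≤ 0}` is an interior critical point.
[folklore] -/
theorem exists_unique_critical (hF : ContDiff ℝ 2 F) (hK : IsCompact {x | F x ≤ 0})
    (hne : ∃ x, F x < 0) (hreg : ∀ x, F x = 0 → fderiv ℝ F x ≠ 0) (hv : v ≠ 0) {p₀ : E}
    (hp₀ : F p₀ = 0) (hup : ∃ c : ℝ, 0 < c ∧ fderiv ℝ F p₀ = c • innerSL ℝ v)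
    (huniq : ∀ p, F p = 0 → (∃ c : ℝ, 0 < c ∧ fderiv ℝ F p = c • innerSL ℝ v) → p = p₀)
    (hpos : ∀ w, ⟪v, w⟫ = 0 → w ≠ 0 → 0 < fderiv ℝ (fderiv ℝ F) p₀ w w) :
    ∃ t : ℝ, 0 < t ∧ ∃ η : ℝ, 0 < η ∧ ∃ x₀ : E, F x₀ < 0 ∧
      fderiv ℝ (fun x => Real.exp (t * ⟪v, x⟫) * F x) x₀ = 0 ∧ IsLocalMin (fun x => Real.exp (t * ⟪v, x⟫) * F x) x₀ ∧
      (∀ u, u ≠ 0 → 0 < fderiv ℝ (fderiv ℝ (fun x => Real.exp (t * ⟪v, x⟫) * F x)) x₀ u u) ∧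
      ∀ x, F x < η → x ∈ thickening 1 {x | F x ≤ 0} →
        fderiv ℝ (fun x => Real.exp (t * ⟪v, x⟫) * F x) x = 0 → x = x₀ := by
  have hFd : Differentiable ℝ F := hF.differentiable (by norm_num)
  have hF1' : ContDiff ℝ 1 F := hF.of_le (by norm_num)
  have hFc : Continuous F := hF.continuous
  have hDc : Continuous (fderiv ℝ F) := hF.continuous_fderiv (by norm_num)
  have hvn : 0 < ‖v‖ := norm_pos_iff.2 hv
  set K : Set E := {x | F x ≤ 0} with hKdef
  set L : Set E := cthickening 1 K with hL
  have hLc : IsCompact L := hK.cthickening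
  have hKL : K ⊆ L := self_subset_cthickening K
  have hTL : thickening 1 K ⊆ L := thickening_subset_cthickening 1 K
  have hp₀K : p₀ ∈ K := by show F p₀ ≤ 0; rw [hp₀]
  -- local constants at `p₀`
  obtain ⟨c₀, hc₀, hDp₀⟩ := hup
  obtain ⟨q, M, n₀, κ, ρ, hq, hM, hn₀, hκ0, hρ, hρ1, hκM, hQ, hMb, hn, hκ⟩ :=
    exists_local_constants hF hv hc₀ hDp₀ hpos
  set W : Set E := ball p₀ ρ with hW
  have hWL : W ⊆ L := (ball_subset_ball hρ1).trans
    ((ball_subset_thickening hp₀K 1).trans hTL)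
  -- global constants
  obtain ⟨M₁, hM₁⟩ := hLc.exists_bound_of_continuousOn hDc.continuousOn
  have hM₁0 : 0 ≤ M₁ := le_trans (norm_nonneg _) (hM₁ p₀ (hKL hp₀K))
  obtain ⟨μ, hμ, ε₁, hε₁, hμε⟩ := exists_norm_fderiv_ge hF1' hLc (fun x _ hx => hreg x hx)
  obtain ⟨ε₂, hε₂, hcone⟩ := exists_pos_forall_mem_of_cone hF1' hv hLc isOpen_ball
    (W := W) (fun x _ hx0 hc => by
      obtain ⟨c, hc, hcx⟩ := hc
      have hcpos : 0 < c := by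
        rcases hc.lt_or_eq with hlt | heq
        · exact hlt
        · exfalso; apply hreg x hx0; rw [hcx, ← heq, zero_smul]
      have := huniq x hx0 ⟨c, hcpos, hcx⟩
      rw [this]; exact mem_ball_self hρ)
  set ε₃ : ℝ := min ε₁ ε₂ with hε₃
  have hε₃0 : 0 < ε₃ := lt_min hε₁ hε₂
  -- the rate `t`
  set T₁ : ℝ := 2 * M * (M / q + 1) / (‖v‖ * n₀) with hT₁
  set T₂ : ℝ := (2 * M ^ 2 / q + M + 1) / (‖v‖ * n₀) with hT₂
  set T₃ : ℝ := (M₁ + 1) / (ε₃ * ‖v‖) with hT₃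
  have hT₁0 : 0 ≤ T₁ := by positivity
  have hT₂0 : 0 ≤ T₂ := by positivity
  have hT₃0 : 0 ≤ T₃ := by positivity
  set t : ℝ := T₁ + T₂ + T₃ + 1 with ht
  have ht0 : 0 < t := by positivity
  have hvn₀ : 0 < ‖v‖ * n₀ := mul_pos hvn hn₀
  have ht₁ : 2 * M * (M / q + 1) < t * ‖v‖ * n₀ := by
    have e1 : T₁ * (‖v‖ * n₀) = 2 * M * (M / q + 1) := div_mul_cancel₀ _ hvn₀.ne'
    have hlt : T₁ < t := by linarith only [hT₂0, hT₃0, ht]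
    rw [show t * ‖v‖ * n₀ = t * (‖v‖ * n₀) by ring, ← e1]
    exact mul_lt_mul_of_pos_right hlt hvn₀
  have ht₂ : 2 * M ^ 2 / q + M + 1 ≤ t * ‖v‖ * n₀ := by
    have e2 : T₂ * (‖v‖ * n₀) = 2 * M ^ 2 / q + M + 1 := div_mul_cancel₀ _ hvn₀.ne'
    have hle : T₂ ≤ t := by linarith only [hT₁0, hT₃0, ht]
    rw [show t * ‖v‖ * n₀ = t * (‖v‖ * n₀) by ring, ← e2]
    exact mul_le_mul_of_nonneg_right hle hvn₀.le
  have ht₃ : M₁ < t * ε₃ * ‖v‖ := by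
    have e3 : T₃ * (ε₃ * ‖v‖) = M₁ + 1 := div_mul_cancel₀ _ (mul_pos hε₃0 hvn).ne'
    have hlt : T₃ < t := by linarith only [hT₁0, hT₂0, ht]
    have : M₁ + 1 < t * (ε₃ * ‖v‖) := by
      rw [← e3]; exact mul_lt_mul_of_pos_right hlt (mul_pos hε₃0 hvn)
    rw [show t * ε₃ * ‖v‖ = t * (ε₃ * ‖v‖) by ring]
    linarith only [this]
  -- the margin `η`
  set η : ℝ := min ε₁ (μ / (2 * t * ‖v‖)) with hη
  have hη0 : 0 < η := lt_min hε₁ (by positivity)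
  -- the minimiser of `G` on `K`
  set G : E → ℝ := fun x => Real.exp (t * ⟪v, x⟫) * F x with hG
  have hGc : Continuous G := (contDiff_expHeight hF t v).continuous
  obtain ⟨xn, hxn⟩ := hne
  obtain ⟨x₀, hx₀K, hmin⟩ := hK.exists_isMinOn ⟨xn, le_of_lt hxn⟩ hGc.continuousOn
  have hGx₀ : G x₀ < 0 := lt_of_le_of_lt (hmin (show xn ∈ K from le_of_lt hxn))
    ((expHeight_neg_iff t v F xn).2 hxn)
  have hFx₀ : F x₀ < 0 := (expHeight_neg_iff t v F x₀).1 hGx₀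
  have hlocmin : IsLocalMin G x₀ :=
    hmin.isLocalMin (mem_of_superset ((isOpen_lt hFc continuous_const).mem_nhds hFx₀)
      fun x hx => show F x ≤ 0 from le_of_lt hx)
  have hcrit₀ : fderiv ℝ G x₀ = 0 := hlocmin.fderiv_eq_zero
  -- critical points with `F < 0` lie in `W`
  have hWcrit : ∀ y, F y < 0 → fderiv ℝ G y = 0 → y ∈ W := by
    intro y hy hyc
    have hyL : y ∈ L := hKL (le_of_lt hy)
    have hnorm : ‖fderiv ℝ F y‖ = |t * F y| * ‖v‖ := norm_fderiv_of_critical (hFd y) hyc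
    -- not deep
    have hshallow : -ε₃ < F y := by
      by_contra hdeep
      push Not at hdeep
      have h1 : t * ε₃ * ‖v‖ ≤ ‖fderiv ℝ F y‖ := by
        rw [hnorm, abs_mul, abs_of_pos ht0, abs_of_neg hy]
        have : ε₃ ≤ -F y := by linarith only [hdeep]
        gcongr
      linarith only [hM₁ y hyL, h1, ht₃]
    refine hcone y hyL (by linarith only [min_le_right ε₁ ε₂, hshallow, hε₃]) hy.le
      ⟨-(t * F y), ?_, ?_⟩
    · rw [neg_mul_eq_mul_neg]
      exact (mul_pos ht0 (neg_pos.2 hy)).le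
    · exact (fderiv_expHeight_eq_zero_iff t v (hFd y)).1 hyc
  have hx₀W : x₀ ∈ W := hWcrit x₀ hFx₀ hcrit₀
  refine ⟨t, ht0, η, hη0, x₀, hFx₀, hcrit₀, hlocmin, fun u hu => ?_, fun x hxη hxT hxc => ?_⟩
  · exact fderiv_fderiv_expHeight_pos hF hv hq hn₀ hQ hMb hn ht₂ hx₀W hcrit₀ hu
  · have hxL : x ∈ L := hTL hxT
    rcases lt_trichotomy (F x) 0 with hneg | hzero | hpos
    · exact (critical_unique hF hv (convex_ball p₀ ρ) hq hn₀ hκ0 hQ hMb hn hκ hκM ht₁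
        hx₀W (hWcrit x hneg hxc) hcrit₀ hxc).symm
    · exfalso
      have := (fderiv_expHeight_eq_zero_iff t v (hFd x)).1 hxc
      rw [hzero, mul_zero, neg_zero, zero_smul] at this
      exact hreg x hzero this
    · exfalso
      have hxε : |F x| ≤ ε₁ := by
        rw [abs_of_pos hpos]; exact le_trans hxη.le (min_le_left _ _)
      have hlow := hμε x hxL hxε
      have hnorm : ‖fderiv ℝ F x‖ = |t * F x| * ‖v‖ := norm_fderiv_of_critical (hFd x) hxc
      rw [hnorm, abs_of_pos (mul_pos ht0 hpos)] at hlow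
      have hxη' : F x < μ / (2 * t * ‖v‖) := lt_of_lt_of_le hxη (min_le_right _ _)
      have h2 : t * F x * ‖v‖ < μ / 2 := by
        have h3 := mul_lt_mul_of_pos_left hxη' (mul_pos ht0 hvn)
        have e : t * ‖v‖ * (μ / (2 * t * ‖v‖)) = μ / 2 := by
          field_simp
        rw [e] at h3
        linarith only [h3]
      linarith only [hlow, h2, hμ]

end Global

/-! ### §8b The top point of a compact regular domain -/

section Top

variable {F : E → ℝ} {v : E}

/-- Near a point where `F < 0` one can move a little in the direction `v` staying in `{F < 0}`.
[folklore] -/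
theorem exists_pos_apply_add_smul_lt (hFc : Continuous F) {y : E} (hy : F y < 0) (v : E) :
    ∃ ε : ℝ, 0 < ε ∧ F (y + ε • v) < 0 := by
  have hev : ∀ᶠ ε in 𝓝 (0 : ℝ), F (y + ε • v) < 0 := by
    have hc : Continuous fun ε : ℝ => F (y + ε • v) :=
      hFc.comp (continuous_const.add (continuous_id.smul continuous_const))
    exact hc.continuousAt.eventually_lt continuousAt_const (by simpa using hy)
  obtain ⟨δ, hδ, hball⟩ := Metric.eventually_nhds_iff_ball.1 hev
  exact ⟨δ / 2, by positivity, hball _ (by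
    rw [mem_ball, Real.dist_eq, sub_zero, abs_of_pos (by positivity)]; linarith)⟩

/-- **The height attains its maximum over `{F ≤ 0}` on the zero set.**  If `A = {F ≤ 0}` is
compact with a point where `F < 0`, then `⟪v, ·⟫` attains its maximum over `A` at some point `p`,
and `F p = 0` when `v ≠ 0` (otherwise `p + εv ∈ A` would be higher). [folklore] -/
theorem exists_isMaxOn_apply_eq_zero (hFc : Continuous F) (hK : IsCompact {x | F x ≤ 0})
    (hne : ∃ x, F x < 0) (hv : v ≠ 0) :
    ∃ p, F p = 0 ∧ IsMaxOn (fun x => ⟪v, x⟫) {x | F x ≤ 0} p := by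
  obtain ⟨x₁, hx₁⟩ := hne
  have hc : Continuous fun x : E => ⟪v, x⟫ :=
    continuous_inner.comp (continuous_const.prodMk continuous_id)
  obtain ⟨p, hpK, hmax⟩ := hK.exists_isMaxOn ⟨x₁, le_of_lt hx₁⟩ hc.continuousOn
  refine ⟨p, ?_, hmax⟩
  rcases (show F p ≤ 0 from hpK).lt_or_eq with hlt | heq
  · exfalso
    -- `F < 0` near `p`, so `p + ε v ∈ A` for small `ε > 0`
    obtain ⟨ε, hε, hεF⟩ := exists_pos_apply_add_smul_lt hFc hlt v
    have h1 : ⟪v, p + ε • v⟫ ≤ ⟪v, p⟫ := hmax (show F (p + ε • v) ≤ 0 from hεF.le)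
    rw [inner_add_right, real_inner_smul_right, real_inner_self_eq_norm_sq] at h1
    have : 0 < ε * ‖v‖ ^ 2 := by positivity
    linarith
  · exact heq

/-- Along a direction `w` with `DF(p) w < 0`, the function `F` (vanishing at `p`) becomes negative:
`F (p + s w) < 0` for small `s > 0`. [folklore] -/
theorem exists_pos_apply_add_smul_neg (hF : Differentiable ℝ F) {p w : E} (hp : F p = 0)
    (hw : fderiv ℝ F p w < 0) : ∀ᶠ s in 𝓝[>] (0 : ℝ), F (p + s • w) < 0 := by
  have hd : HasDerivAt (fun s : ℝ => F (p + s • w)) (fderiv ℝ F p w) 0 := by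
    have := hasDerivAt_comp_line hF p w 0
    simpa using this
  have ht : Tendsto (slope (fun s : ℝ => F (p + s • w)) 0) (𝓝[>] 0) (𝓝 (fderiv ℝ F p w)) :=
    (hasDerivAt_iff_tendsto_slope.1 hd).mono_left (nhdsWithin_mono _ fun s hs => ne_of_gt hs)
  filter_upwards [ht.eventually_lt_const hw, self_mem_nhdsWithin] with s hs hs0
  rw [slope_def_field, zero_smul, add_zero, hp, sub_zero, sub_zero] at hs
  exact ((div_neg_iff.1 hs).resolve_left fun h => lt_asymm hs0 h.2).1

/-- **Lagrange at the top point.** At a point `p` of the zero set maximising `⟪v, ·⟫` over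
`A = {F ≤ 0}`, with `DF(p) ≠ 0`, the derivative `DF(p)` is a *positive* multiple of `⟪v, ·⟫`:
the half-space `{DF(p) < 0}` of inward directions lies in `{⟪v, ·⟫ ≤ 0}`. [folklore] -/
theorem exists_pos_fderiv_eq_smul_of_isMaxOn (hF : ContDiff ℝ 1 F) {p : E} (hp : F p = 0)
    (hmax : IsMaxOn (fun x => ⟪v, x⟫) {x | F x ≤ 0} p) (hreg : fderiv ℝ F p ≠ 0) (hv : v ≠ 0) :
    ∃ c : ℝ, 0 < c ∧ fderiv ℝ F p = c • innerSL ℝ v := by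
  have hFd : Differentiable ℝ F := hF.differentiable one_ne_zero
  set A := fderiv ℝ F p with hA
  -- Step 1: `A w < 0 → ⟪v, w⟫ ≤ 0`
  have step1 : ∀ w, A w < 0 → ⟪v, w⟫ ≤ 0 := by
    intro w hw
    obtain ⟨s, hs, hs0⟩ := ((exists_pos_apply_add_smul_neg hFd hp hw).and
      self_mem_nhdsWithin).exists
    have h1 : ⟪v, p + s • w⟫ ≤ ⟪v, p⟫ := hmax (show F (p + s • w) ≤ 0 from hs.le)
    rw [inner_add_right, real_inner_smul_right] at h1
    have h2 : s * ⟪v, w⟫ ≤ 0 := by linarith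
    by_contra h3
    push Not at h3
    have := mul_pos hs0 h3
    linarith
  -- a direction `u` with `A u < 0`
  obtain ⟨u, hu⟩ : ∃ u, A u < 0 := by
    obtain ⟨u₀, hu₀⟩ : ∃ u₀, A u₀ ≠ 0 := by
      by_contra hall
      push Not at hall
      exact hreg (ContinuousLinearMap.ext hall)
    rcases hu₀.lt_or_gt with hlt | hgt
    · exact ⟨u₀, hlt⟩
    · exact ⟨-u₀, by rw [map_neg]; linarith⟩
  -- Step 2: `A w = 0 → ⟪v, w⟫ = 0`
  have step2 : ∀ w, A w = 0 → ⟪v, w⟫ = 0 := by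
    have aux : ∀ w, A w = 0 → ⟪v, w⟫ ≤ 0 := by
      intro w hw
      have hε : ∀ ε, 0 < ε → ⟪v, w⟫ ≤ ε * (-⟪v, u⟫) := by
        intro ε hε
        have h1 : A (w + ε • u) < 0 := by
          rw [map_add, map_smul, hw, zero_add, smul_eq_mul]; exact mul_neg_of_pos_of_neg hε hu
        have h2 := step1 _ h1
        rw [inner_add_right, real_inner_smul_right] at h2
        linarith
      by_contra hpos
      push Not at hpos
      by_cases hb : -⟪v, u⟫ ≤ 0
      · have := hε 1 one_pos; linarith
      · push Not at hb
        have h3 := hε (⟪v, w⟫ / (2 * -⟪v, u⟫)) (by positivity)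
        have hbu : ⟪v, u⟫ ≠ 0 := by intro h; rw [h, neg_zero] at hb; exact lt_irrefl _ hb
        have h4 : ⟪v, w⟫ / (2 * -⟪v, u⟫) * -⟪v, u⟫ = ⟪v, w⟫ / 2 := by
          rw [div_mul_eq_mul_div, mul_div_mul_right _ _ (neg_ne_zero.2 hbu)]
        rw [h4] at h3
        linarith
    intro w hw
    have h1 := aux w hw
    have h2 := aux (-w) (by rw [map_neg, hw, neg_zero])
    rw [inner_neg_right] at h2
    linarith
  -- Step 3: proportionality
  have hprop : ∀ w, ⟪v, w⟫ = (⟪v, u⟫ / A u) * A w := by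
    intro w
    have hker : A (w - (A w / A u) • u) = 0 := by
      rw [map_sub, map_smul, smul_eq_mul, div_mul_cancel₀ _ hu.ne, sub_self]
    have h0 := step2 _ hker
    rw [inner_sub_right, real_inner_smul_right] at h0
    have h1 : ⟪v, w⟫ = A w / A u * ⟪v, u⟫ := by linarith
    rw [h1]
    ring
  set c : ℝ := ⟪v, u⟫ / A u with hc
  have hc0 : 0 ≤ c := div_nonneg_iff.2 (Or.inr ⟨step1 u hu, hu.le⟩)
  have hcne : c ≠ 0 := by
    intro h0
    have h1 := hprop v
    rw [h0, zero_mul, real_inner_self_eq_norm_sq] at h1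
    exact hv (norm_eq_zero.1 (pow_eq_zero_iff two_ne_zero |>.1 h1))
  have hcpos : 0 < c := lt_of_le_of_ne hc0 (Ne.symm hcne)
  refine ⟨c⁻¹, inv_pos.2 hcpos, ContinuousLinearMap.ext fun w => ?_⟩
  rw [FunLike.coe_smul, Pi.smul_apply, innerSL_apply_apply, hprop w, smul_eq_mul,
    ← mul_assoc, inv_mul_cancel₀ hcne, one_mul]

/-- **Second-order condition at the top point.** At a point `p` of the zero set maximising
`⟪v, ·⟫` over `{F ≤ 0}`, for every `w ⊥ v` with `DF(p) w = 0` one has `D²F(p)(w, w) ≥ 0`: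
`F ≥ 0` on the hyperplane `p + vᗮ` (a negative value there could be pushed up in the direction
`v`), so `s ↦ F(p + s w)` has a minimum at `0`. [folklore] -/
theorem fderiv_fderiv_nonneg_of_isMaxOn (hF : ContDiff ℝ 2 F) {p : E} (hp : F p = 0)
    (hmax : IsMaxOn (fun x => ⟪v, x⟫) {x | F x ≤ 0} p) (hv : v ≠ 0) {w : E} (hw : ⟪v, w⟫ = 0)
    (hAw : fderiv ℝ F p w = 0) : 0 ≤ fderiv ℝ (fderiv ℝ F) p w w := by
  have hFc : Continuous F := hF.continuous
  have hFd : Differentiable ℝ F := hF.differentiable (by norm_num)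
  have hF1 : ContDiff ℝ 1 (fderiv ℝ F) := ((contDiff_succ_iff_fderiv (n := 1)).1 hF).2.2
  have hFd' : Differentiable ℝ (fderiv ℝ F) := hF1.differentiable one_ne_zero
  have hD2c : Continuous (fderiv ℝ (fderiv ℝ F)) := hF1.continuous_fderiv one_ne_zero
  have hvn : 0 < ‖v‖ := norm_pos_iff.2 hv
  -- `g s = F (p + s w) ≥ 0`
  set g : ℝ → ℝ := fun s => F (p + s • w) with hg
  have hg0 : ∀ s, 0 ≤ g s := by
    intro s
    by_contra hneg
    push Not at hneg
    obtain ⟨ε, hε, hεF⟩ := exists_pos_apply_add_smul_lt hFc hneg v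
    have h1 : ⟪v, p + s • w + ε • v⟫ ≤ ⟪v, p⟫ := hmax (show F (p + s • w + ε • v) ≤ 0 from hεF.le)
    rw [inner_add_right, inner_add_right, real_inner_smul_right, real_inner_smul_right, hw,
      mul_zero, add_zero, real_inner_self_eq_norm_sq] at h1
    have : 0 < ε * ‖v‖ ^ 2 := by positivity
    linarith
  -- derivatives of `g`
  set g1 : ℝ → ℝ := fun s => fderiv ℝ F (p + s • w) w with hg1
  set g2 : ℝ → ℝ := fun s => fderiv ℝ (fderiv ℝ F) (p + s • w) w w with hg2
  have hgd : ∀ s, HasDerivAt g (g1 s) s := fun s => hasDerivAt_comp_line hFd p w s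
  have hg1d : ∀ s, HasDerivAt g1 (g2 s) s := fun s => hasDerivAt_fderiv_comp_line_apply hFd' p w w s
  have hg2c : Continuous g2 :=
    ((hD2c.comp (continuous_const.add (continuous_id.smul continuous_const))).clm_apply
      continuous_const).clm_apply continuous_const
  by_contra hd
  push Not at hd
  set d := fderiv ℝ (fderiv ℝ F) p w w with hdd
  -- `g2 < d / 2 < 0` on `[0, δ]`
  have hev : ∀ᶠ s in 𝓝 (0 : ℝ), g2 s < d / 2 :=
    hg2c.continuousAt.eventually_lt continuousAt_const (by
      simp only [hg2, zero_smul, add_zero]; linarith)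
  obtain ⟨δ₀, hδ₀, hball⟩ := Metric.eventually_nhds_iff_ball.1 hev
  set δ := δ₀ / 2 with hδ
  have hδ0 : 0 < δ := by positivity
  have hg2neg : ∀ s, 0 ≤ s → s ≤ δ → g2 s < 0 := by
    intro s hs0 hsδ
    have : s ∈ ball (0 : ℝ) δ₀ := by
      rw [mem_ball, Real.dist_eq, sub_zero, abs_of_nonneg hs0]; linarith
    linarith [hball s this]
  -- `g1 < 0` on `(0, δ]`
  have hg1neg : ∀ ξ, 0 < ξ → ξ ≤ δ → g1 ξ < 0 := by
    intro ξ hξ0 hξδ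
    obtain ⟨ζ, hζ, hζeq⟩ := exists_hasDerivAt_eq_slope g1 g2 hξ0
      (fun s _ => (hg1d s).continuousAt.continuousWithinAt) (fun s _ => hg1d s)
    have h10 : g1 0 = 0 := by simp only [hg1, zero_smul, add_zero]; exact hAw
    rw [h10, sub_zero, sub_zero] at hζeq
    have hζneg := hg2neg ζ hζ.1.le (hζ.2.le.trans hξδ)
    rw [hζeq] at hζneg
    exact (div_neg_iff.1 hζneg).resolve_left (fun h => lt_asymm hξ0 h.2) |>.1
  -- `g δ < 0`, a contradiction
  obtain ⟨ξ, hξ, hξeq⟩ := exists_hasDerivAt_eq_slope g g1 hδ0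
    (fun s _ => (hgd s).continuousAt.continuousWithinAt) (fun s _ => hgd s)
  have h00 : g 0 = 0 := by simp only [hg, zero_smul, add_zero]; exact hp
  rw [h00, sub_zero, sub_zero] at hξeq
  have h1 := hg1neg ξ hξ.1 hξ.2.le
  rw [hξeq, div_neg_iff] at h1
  rcases h1 with h1 | h1
  · exact lt_asymm hδ0 h1.2
  · linarith [hg0 δ, h1.1]

/-- **Positive definiteness from semidefiniteness and nondegeneracy** (on `vᗮ`): a symmetric
bilinear form which is `≥ 0` on `vᗮ` and nondegenerate there is positive definite there
(if `D(w,w) = 0` then `s ↦ D(w + s w', w + s w') ≥ 0` forces `D(w, w') = 0`). [folklore] -/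
theorem pos_of_nonneg_of_separating {D : E →L[ℝ] E →L[ℝ] ℝ} (hsymm : ∀ u w, D u w = D w u)
    (hnn : ∀ w, ⟪v, w⟫ = 0 → 0 ≤ D w w)
    (hsep : ∀ w, ⟪v, w⟫ = 0 → (∀ w', ⟪v, w'⟫ = 0 → D w w' = 0) → w = 0) :
    ∀ w, ⟪v, w⟫ = 0 → w ≠ 0 → 0 < D w w := by
  intro w hw hne
  rcases (hnn w hw).lt_or_eq with hlt | heq
  · exact hlt
  exfalso
  refine hne (hsep w hw fun w' hw' => ?_)
  set b := D w w' with hb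
  set q := D w' w' with hq
  have hq0 : 0 ≤ q := hnn w' hw'
  have key : ∀ s : ℝ, 0 ≤ 2 * s * b + s ^ 2 * q := by
    intro s
    have h1 := hnn (w + s • w') (by rw [inner_add_right, real_inner_smul_right, hw, hw', mul_zero,
      add_zero])
    have h2 : D (w + s • w') (w + s • w') = 2 * s * b + s ^ 2 * q := by
      simp only [map_add, map_smul, add_apply, FunLike.coe_smul, Pi.smul_apply, smul_eq_mul]
      rw [← heq, hsymm w' w, ← hb, ← hq]
      ring
    rw [h2] at h1
    exact h1
  by_contra hb0
  have hpos : 0 < b ^ 2 := by positivity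
  have h1 := key (-b / (q + 1))
  have h2 : 2 * (-b / (q + 1)) * b + (-b / (q + 1)) ^ 2 * q = -(b ^ 2 * (q + 2) / (q + 1) ^ 2) := by
    field_simp
    ring
  rw [h2] at h1
  have h3 : 0 < b ^ 2 * (q + 2) / (q + 1) ^ 2 := by positivity
  linarith

/-- **A unique upward-normal point from two normal points.**  Let `A = {F ≤ 0}` be a compact
regular domain (`F` of class `C²`, `DF ≠ 0` on `{F = 0}`, nonempty interior) and `v ≠ 0`.
Suppose the points of the boundary at which `DF` is parallel to `⟪v, ·⟫` — the critical points
of the height `⟪v, ·⟫` on the boundary — are among two points `p₁, p₂`, and at each of them the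
Hessian `D²F` restricted to `vᗮ` is nondegenerate.  Then the hypotheses of
`exists_unique_critical` hold at the top point `p₀` (the boundary point of maximal height): the
bottom point has a *negative* multiple, and at the top point `D²F|vᗮ` is positive semidefinite,
hence positive definite.
This is the hypothesis "`h|S` is a Morse function with exactly two critical points" of
Schultens (2014), proof of Thm. 3.2.5, case `n = 0`, for the region bounded by `S`.
[cite: Schultens2014, proof of Thm. 3.2.5, case n = 0 (PDF p. 44)] -/
theorem exists_unique_upNormal_of_pair (hF : ContDiff ℝ 2 F) (hK : IsCompact {x | F x ≤ 0})
    (hne : ∃ x, F x < 0) (hreg : ∀ x, F x = 0 → fderiv ℝ F x ≠ 0) (hv : v ≠ 0) {p₁ p₂ : E}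
    (hP : ∀ p, F p = 0 → (∃ c : ℝ, fderiv ℝ F p = c • innerSL ℝ v) → p = p₁ ∨ p = p₂)
    (hnd : ∀ p, F p = 0 → (∃ c : ℝ, fderiv ℝ F p = c • innerSL ℝ v) →
      ∀ w, ⟪v, w⟫ = 0 → (∀ w', ⟪v, w'⟫ = 0 → fderiv ℝ (fderiv ℝ F) p w w' = 0) → w = 0) :
    ∃ p₀, F p₀ = 0 ∧ (∃ c : ℝ, 0 < c ∧ fderiv ℝ F p₀ = c • innerSL ℝ v) ∧
      (∀ p, F p = 0 → (∃ c : ℝ, 0 < c ∧ fderiv ℝ F p = c • innerSL ℝ v) → p = p₀) ∧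
      ∀ w, ⟪v, w⟫ = 0 → w ≠ 0 → 0 < fderiv ℝ (fderiv ℝ F) p₀ w w := by
  have hFc : Continuous F := hF.continuous
  have hF1 : ContDiff ℝ 1 F := hF.of_le (by norm_num)
  -- top and bottom points
  obtain ⟨pM, hpM0, hpMmax⟩ := exists_isMaxOn_apply_eq_zero hFc hK hne hv
  obtain ⟨cM, hcM, hDpM⟩ := exists_pos_fderiv_eq_smul_of_isMaxOn hF1 hpM0 hpMmax (hreg pM hpM0) hv
  have hv' : -v ≠ 0 := neg_ne_zero.2 hv
  obtain ⟨pm, hpm0, hpmmax⟩ := exists_isMaxOn_apply_eq_zero hFc hK hne hv'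
  obtain ⟨cm, hcm, hDpm⟩ := exists_pos_fderiv_eq_smul_of_isMaxOn hF1 hpm0 hpmmax (hreg pm hpm0) hv'
  rw [map_neg, smul_neg, ← neg_smul] at hDpm
  -- a positive multiple and a negative multiple differ
  have hsep : ∀ {p : E} {c c' : ℝ}, 0 < c → 0 < c' → fderiv ℝ F p = c • innerSL ℝ v →
      fderiv ℝ F p = (-c') • innerSL ℝ v → False := by
    intro p c c' hc hc' h1 h2
    have h3 : (c + c') • innerSL ℝ v = 0 := by
      rw [add_smul, ← h1, h2, neg_smul, neg_add_cancel]
    have h4 := congrArg (fun f : E →L[ℝ] ℝ => f v) h3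
    simp only [FunLike.coe_smul, Pi.smul_apply, innerSL_apply_apply, smul_eq_mul,
      zero_apply, real_inner_self_eq_norm_sq] at h4
    rcases mul_eq_zero.1 h4 with h5 | h5
    · linarith
    · exact hv (norm_eq_zero.1 ((pow_eq_zero_iff two_ne_zero).1 h5))
  have hMm : pM ≠ pm := fun h => hsep hcM hcm hDpM (h ▸ hDpm)
  -- the top point is the unique upward-normal point
  have hPM := hP pM hpM0 ⟨cM, hDpM⟩
  have hPm := hP pm hpm0 ⟨-cm, hDpm⟩
  refine ⟨pM, hpM0, ⟨cM, hcM, hDpM⟩, fun p hp0 ⟨c, hc, hDp⟩ => ?_, ?_⟩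
  · rcases hP p hp0 ⟨c, hDp⟩ with rfl | rfl
    · rcases hPM with h | h
      · exact h.symm
      · rcases hPm with h' | h'
        · exact (hsep hc hcm hDp (h' ▸ hDpm)).elim
        · exact (hMm (h.trans h'.symm)).elim
    · rcases hPM with h | h
      · rcases hPm with h' | h'
        · exact (hMm (h.trans h'.symm)).elim
        · exact (hsep hc hcm hDp (h' ▸ hDpm)).elim
      · exact h.symm
  · -- positive definiteness at the top point
    have hsymm : ∀ u w, fderiv ℝ (fderiv ℝ F) pM u w = fderiv ℝ (fderiv ℝ F) pM w u :=
      fun u w => (hF.contDiffAt.isSymmSndFDerivAt (by simp)) u w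
    refine pos_of_nonneg_of_separating hsymm (fun w hw => ?_) (hnd pM hpM0 ⟨cM, hDpM⟩)
    refine fderiv_fderiv_nonneg_of_isMaxOn hF hpM0 hpMmax hv hw ?_
    rw [hDpM, FunLike.coe_smul, Pi.smul_apply, innerSL_apply_apply, hw, smul_zero]

end Top

end ExpHeight

end Literature.Topology.FourManifolds

end
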